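import Summits.HodgeConjecture.HodgeConjecture.Cruxes.BlochSeedDiscOne.SeedCheckerPorteous
import Summits.HodgeConjecture.HodgeConjecture.Cruxes.BlochSeedDiscOne.MonadAlphabet
import HarnessLib

/-!
# Seed checker v26 — THE COMPOUND-FRAME ADAPTER: a seed checker for designs over the NON-BOX alphabet (`XWord`, `∧^• M`),
tensor level, by name for `nonboxAlphabet` monad designs ∕ presentations (v25, hsemireg-c5c8-1 g24, 2026-08-30) + §26 THE JSON-SIDE
DICTIONARY (calibration) THEOREM, PROVED: `compoundCh 1 (boxMatrix Z) = xT (MCell.ch Z)` — the compound checker restricted to box designs IS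
the box checker (v26, hsemireg-c5c8-1 g25, 2026-08-30)

Crux of record `Summit.HodgeConjecture.HodgeConjecture.Theses.EightfoldBlochSeeds.BlochSeedDiscOne` (item stmt-HodgeConjecture-18881;
line token `Lines/birth.lean` 814a6a70c14e831a `stub_rung_pad4_seedAt` — positive side: ONE (A1)-clean design with `μ ≠ 0` realised by a
vector bundle ∕ lci seed = a SEED). ADDITIVE SATELLITE of the BUILT v4 `SeedChecker.lean` (13437bb9848c3c36; imported through the BUILT v5
`SeedCheckerPorteous.lean`, whose kit-level sheaf door `hasHyperbolicBFSheafSeedOn_of_cleanAtSeed` is reused) and of typer-3's BUILT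
`MonadAlphabet.lean` (§7: `XWord`, `minor`, `compoundCh`, `XScreen`, `NonboxLetter`, `nonboxAlphabet`, `MonadDesign.rankX ∕ muX ∕ muBarX ∕ CleanX`).
No declaration of any earlier file is changed or shadowed; v23 `SeedCheckerNewtonClosure` and v24 `SeedCheckerAlphabet` are in the tree but NOT
BUILT on the farm snapshot (`lean check` rc 75 `stale:4137` ∕ `stale:4135`), so they are NOT imported: the three v24 devices this file needs
(frame read over a scale, tensor-level collapse, tame tensors) are RE-TYPED here ON THE COMPOUND FRAME under NEW names (`WeilFrame.overScale`,
`AnchorKit.overScale`, `XTame`, `cleanAtSeed_of_xRealisesTensor…`) — nothing of v24 is restated on the box frame.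

## §0 Honest framing

Typed by planner seat `hsemireg-c5c8-1` (gens 24–25; director-hodge MINT «C5–C8: σ = the Hodge class check, (A1)-cleanliness AT THE SEED, pad4-tower
compatibility with `stub_rung_pad4_seedAt`'s binders, disc-one — each a predicate on (design json, presentation) so a seed checker exists before
a candidate does; flag the vacuous ∕ implied ones; nothing is proved toward HC»). EVERYTHING below is a definition (predicate ∕ structure built from
GIVEN data), a finite combinatorial lemma about words ∕ minors, or an implication whose hypotheses carry ALL the geometric content (anchor kit,
compound word frame + its laws, the realising sheaf and the sentence «it realises the tensor», local freeness, `I`-semiregularity, the zero scheme,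
v4's `TopChernFourLocalisation` law). NO frame, kit, bundle, monad, section or subscheme is constructed; NO instance of `XWordFrame.LinksTo`,
`XRealisesTensor(AtScale)`, `IsISemiregular`, `IsBlochSemiregular` is produced. NOTHING here is proved toward HC ∕ HC_CM ∕ HC_AV ∕ №4 ∕ 26512 ∕ 18881 ∕
H2; the crux item, the line and `stub_rung_pad4_seedAt` are untouched (no rung). This seat produces evidence and typed files, not rungs.

## §1 The gap this file closes (g23 flag (v) «NOT COVERED: `nonboxAlphabet : CellAlphabet GaussianInt XWord` — no word frame for `XWord`»)

Every checker of record (v4 `Design.SeedCheck ∕ SheafSeedCheck`, v4 §6 `RealisesTensor` + the collapse, v24's alphabet adapter) reads class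
tensors on the BOX frame `CWord = Fin 4 → Fin 6` (`6⁴` words `⊗_f {1, u, v, e, ē, p}`). The non-box semi-homogeneous letters of block B1
(semihom-2 SPEC-NONBOX; director R19.212 «alphabet NON-BOX: OPEN — LIVE ×1»; semihom-2 CROSS LAW booked 2026-08-30) live on the COMPOUND frame of
`X = E⁸`: words `(I, J)`, `I, J ⊆ {0..7}` (`dz_I ∧ dz̄_J`), `ch_k(L_M) ↔ ∧^k M` (minors `det M[I;J]`), `h^k∕k! ↔ Id`, Weil plane `⟨(I₀;J₀), (J₀;I₀)⟩`
(`MonadAlphabet` §7, typed there WITHOUT an anchor-side reading). This file supplies the anchor-side reading and the doors, so that a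
(design json over `nonboxAlphabet`, presentation) pair has a CHECKER before any such candidate exists:

* §25.1 word combinatorics: `xwordsOfSize k` (bidegree `(k,k)`), `diagXWords k` («e-free»), `offDiagXWords k` («e-mixed»), `xrefSet k`, the
  diagonal coefficient `xcoeff T k = λ_k`; `|I₀| = |J₀| = 4`, `E ≠ Ē` [`decide`].
* §25.2 **`XWordFrame E₀`** (INTERFACE, obligation O-XF: a class `xcls k (I,J) ∈ H^{2k}(S⁴)` per word; dictionary: `xcls 1 ({j};{k}) = dz_j·dz̄_k`-class
  normalised so that `c₁(L_M) = Σ M_{jk} xcls 1 ({j};{k})`, and `xcls k` = the coefficient classes of `c₁^k∕k! = Σ det M[I;J]·xcls k (I;J)`, canonical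
  because the minors of a generic matrix are linearly independent) and its LAWS **`XWordFrame.LinksTo Φ F h`**: (XF1) `Σ_{|I|=k} xcls k (I;I) = h^k∕k!`
  (`h ↔ Id`, `det Id[I;J] = [I = J]`), (XF2) `r₁ = xcls₄ E + xcls₄ Ē`, `r₂ = i·(xcls₄ E − xcls₄ Ē)`; the class a tensor names `XWordFrame.classOf k T =
  Σ_{|I|=|J|=k} T(I;J)·xcls k (I;J)`; the modelling sentences **`XRealisesTensor C Φ 𝓕 T`** (`ch_k(𝓕) = classOf_k T`, `k ≤ 8`) and **`XRealisesTensorAtScale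
  C Φ 𝓕 L T`** (`L^k·ch_k(𝓕) = classOf_k T`: the letters of ONE design carry slope NUMERATORS `M` at ONE common scale `L`, slope `M∕L`, `MonadAlphabet` §7
  critic τ1; `ch_k(E_{M∕L}) = r·L^{-k}·∧^k M`).
* §25.3 **`XTame T`** (diagonal entries self-conjugate, `T(Ē) = conj T(E)`) and THE TENSOR-LEVEL COLLAPSE ON THE COMPOUND FRAME: `XScreen T` ((A1), typer-3)
  + `XTame T` + `Φ.LinksTo F h` ⟹ `classOf_k T = (Re λ_k ∕ k!)·h^k` (`k ≠ 4`), `classOf₄ T = (Re λ₄∕24)·h⁴ + wOf T(E)` ⟹ **`cleanAtSeed_of_xRealisesTensor`**: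
  a sheaf realising a clean tame tensor is (A1)-CLEAN AT THE SEED (v4 `CleanAtSeed`) in every window `⊆ {0..8}`, `W`-coordinate `μ = T(E)` = the WEIL
  MINOR; at scale `L` the same against the Weil frame READ OVER THE SCALE (`WeilFrame.overScale F L = (L⁻⁴·r₁, L⁻⁴·r₂)`, `AnchorKit.overScale`;
  `cleanAtSeed_overScale_of_xRealisesTensorAtScale`).
* §25.4 Hermitian letters are tame: `minor Mᴴ J I = conj (minor M I J)` (`det_conjTranspose` + `det_submatrix_equiv_self`), hence for `Mᴴ = M` the principal
  minors are real and `det M[J₀;I₀] = conj det M[I₀;J₀]`: **`xTame_compoundCh_of_isHerm`**; tameness is closed under `ℤ`-linear combinations, so every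
  monad design ∕ presentation over `nonboxAlphabet` with Hermitian cells has a tame class tensor (`xTame_wch_of_allHermMonad ∕ _of_allHermPres`) — the
  json side of (A1@Z) is `CleanX` + «cells Hermitian» (both decidable per design).
* §25.5 THE DOORS: `XWordKit` (anchor kit + compound frame + laws); **`hasHyperbolicBFSheafSeedOn_of_xTensor`** (sheaf door, tensor level, ANY alphabet on
  `XWord`: clean + tame + `μ ≠ 0` + realised at scale `L` by a finite locally free `I`-semiregular `𝓔`, `4 ∈ I ⊆ {0..8}` ⟹ the tree's
  `HasHyperbolicBFSheafSeedOn C 4 1 I`, via v5's kit-level door on `K.overScale L`); **`classCheck_of_xTensor_zeroScheme`** ((σ) OBJECT HALF, lci door, GIVEN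
  v4's law `TopChernFourLocalisation`: a rank-`4` bundle realising the tensor + a section's zero scheme ⟹ `∃ q, ClassCheck (K.overScale L) μ i q`);
  `SeedCertificate.ofClassCheck` (+ C5–C7 of `i` = a v4 `SeedCertificate`, feeding `seedData_of_certificate ∕ blochSeedDiscOne_of_certificates` UNCHANGED); and
  BY NAME for the non-box alphabet: `hasHyperbolicBFSheafSeedOn_of_nonboxMonadDesign ∕ _of_nonboxPresentation`, `classCheck_of_nonboxMonadDesign_zeroScheme`.
* §25.6 KERNEL PROBE [`decide` on a `1×1` minor]: semihom-2 §C's Fourier letter `[[2I,F₄],[F₄*,2I]]` ALONE is X-tame (Hermitian, §25.4) but NOT clean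
  (`det F[{0};{1}] = 1 ≠ 0` off the Weil pair) — the screen has teeth on the compound frame; (its Weil minor `−16i` is `MonadAlphabet.fourier_probe`).
* §25.7 THE BOX RESTRICTION (one frame serves both alphabets): the dictionary `xwOf : CWord → XWord` (`1 ↦ (∅;∅)`, `u_f ↦ ({2f};{2f})`,
  `v_f ↦ ({2f+1};{2f+1})`, `e_f ↦ ({2f};{2f+1})`, `ē_f ↦ ({2f+1};{2f})`, `p_f ↦ ({2f,2f+1};{2f,2f+1})`, union over factors; `xwOf eeee = E`,
  `xwOf ēēēē = Ē`, `xwOf 1111 = (∅;∅)` [`decide`]); **`xwOf_bijOn`** (PROVED, structurally: letter tables by `decide`, slots `2f+b`, the reading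
  map `wOfX`): on the e-free words of each degree `p` it is a BIJECTION onto the diagonal compound words of size `p`; hence the restricted box frame
  `XWordFrame.toWordFrame` (`cls p w := xcls p (xwOf w)`) of a linked compound frame is a linked box frame in v4's sense —
  **`XWordFrame.linksTo_toWordFrame`** ((XF1) ⟹ (F1) along the bijection, (XF2) ⟹ (F2)): O-WF ⟸ O-XF.
* §26 (v26) **THE JSON-SIDE DICTIONARY (calibration) THEOREM, PROVED** (g23 flag (v) ∕ g24 §2 «NOT COVERED»; semihom-2 §B T2-CALIBRATION was numeric
  only; `MonadAlphabet` §7 records it as unproved): (D1) **`minor_boxMatrix_xwOf`**: `det M_Z[xwOf w] = ch_Z(w)` for EVERY box cell `Z` and EVERY box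
  word `w` (structural proof, no `decide` over words: `enum8 (xwOf w)` = concatenation of per-factor slot lists; PEELING `det_subLL_append` =
  `det_fromBlocks_zero₂₁` along `Fin |A| ⊕ Fin |B| ≃ Fin |A ++ B|`; per-letter blocks `1, α, α, β, β̄, α² − ββ̄`); (D2)
  **`minor_boxMatrix_eq_zero_of_not_xBalanced`**: `det M_Z[I;J] = 0` off the BLOCK-BALANCED words (`XBalanced`; = the image of `xwOf`,
  `xBalanced_iff_exists`; `xwOf_injective` on ALL words) by «`p` rows supported in `< p` columns ⟹ det = 0» (`det_eq_zero_of_rows_supported`);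
  packaged as **`compoundCh_boxMatrix : compoundCh 1 (boxMatrix Z) = xT (MCell.ch Z)`** with the TRANSPORT `xT T (I;J) := T (word read) ∕ 0`
  (`ℤ`-linear, injective, `xT T E = T eeee`, `xT T Ē = T ēēēē`, `xT T (∅;∅) = T 1111`). CONSEQUENCES: **`xScreen_xT_iff : XScreen (xT T) ↔ ClassScreen T`**
  (the two (A1)-screens agree); `isHerm_ofMCell` (block matrices are Hermitian); for a box monad design re-read on the compound frame (`toNonbox D`:
  cells ↦ block matrices, multiplicities along) **`wch_toNonbox : wch (toNonbox D) = xT (wch D)`**, hence `cleanX_toNonbox_iff`, `muX_toNonbox`,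
  `muBarX_toNonbox`, `rankX_toNonbox`, `allHermMonad_toNonbox`, **`toNonbox_jsonSide_iff`** (the compound door's json-side hypotheses for `toNonbox D` ⟺
  the box ones for `D`); on frames **`XWordFrame.classOf_xT : Φ.classOf k (xT T) = Φ.toWordFrame.classOf k T`**, `xRealisesTensor_xT_iff`,
  `xRealisesTensorAtScale_xT_iff`; and the box door THROUGH the compound door `hasHyperbolicBFSheafSeedOn_of_boxMonadDesign_viaCompound`. So the
  compound-frame checker RESTRICTED to box designs is LITERALLY the box checker: the compound frame adds cells, never changes a verdict.

## §2 C5–C8 on the compound frame — flags (what is vacuous, implied, or not covered)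

* (d=1) disc-one: VACUOUS as a check (in the types: `weilClassesOf … 4 1`, `IsHyperbolicWeilType`; v4 `symH_discOne`) — unchanged.
* (σ) design half = `muX ≠ 0` (the Weil minor `Σ ±m·rk·det M[I₀;J₀] ≠ 0`, decidable); object half = `classCheck_of_xTensor_zeroScheme` GIVEN the law
  (lci door) — exactly as on the box frame; NOT implied by C0–C4.
* (A1@Z) IMPLIED: `CleanX` (= (A1) = C0 on the compound frame) + Hermitian cells (tameness; automatic for semihom-2's `Herm₈(ℤ[i])` letters, a genuine
  check only because `NonboxLetter` does not carry `IsHerm` as a field) + the realisation sentence ⟹ `CleanAtSeed` (§25.3); no separate seed-level check.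
* (pad4) compatibility with `stub_rung_pad4_seedAt`'s binders: FREE — same `AnchorKit`, same `pad4Anchor ∕ pad4Action`, kit read over the scale
  (`AnchorKit.overScale` keeps `η`, `pol`, hyperbolicity; only `r₁, r₂` are divided by `L⁴`, still rational Weil classes).
* C5 (lci ∕ locally free), C6 (integral), C7 (semiregular): HYPOTHESES of the doors, untouched (object side; H2 is the whole content).
* O-XF (a linked compound frame EXISTS) is NOT asserted. FLAG: as a bare existence statement `∃ Φ, Φ.LinksTo F h` it is TRIVIALLY inhabited
  (`xcls k (I;I) := (C(8,k)·k!)⁻¹·h^k`, `xcls₄ E := (r₁ − i·r₂)∕2`, `xcls₄ Ē := (r₁ + i·r₂)∕2`, all else `0`) — so O-XF carries NO content by itself; the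
  content is in the MODELLING SENTENCES `XRealisesTensor(AtScale) C Φ (L_M) (compoundCh r M)` for the actual semi-homogeneous bundles (obligation
  O-Xcells, per letter: Mukai ∕ semihom-2 §A «`ch(E_δ) = r(δ)·exp δ`»), which pin `Φ` down. The HONEST frame (ordered cup products of the sixteen
  pulled-back `ψ`-eigenclasses of `H¹`) needs the graded-commutative cup product on the anchor (`cupProduct_gradedComm_holds`-type input) and is not
  constructed here — say so.
* COVERED SINCE v26 (§26): the json-side dictionary theorem «`compoundCh 1 (boxMatrix Z)` on box words `xwOf w` = `MCell.ch Z w`, and `0` off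
  `xwOf (CWord)`» (`compoundCh_boxMatrix`; it was semihom-2 §B's numeric calibration and `MonadAlphabet` §7's recorded gap) — so `toWordFrame` ∕ `toNonbox`
  carry the box checker over to the compound frame verbatim (`xScreen_xT_iff`, `muX_toNonbox`, `XWordFrame.classOf_xT`). STILL NOT COVERED: Mukai's `r(δ)`
  (the SPEC's); a positive toy (a clean NON-box tensor with `μ ≠ 0` needs semihom-2's `Γ₀`-symmetrised designs, i.e. their json, not a single letter);
  v4's `Design` (A ∕ N ∕ P json of record) ↔ `MonadAlphabet.MonadDesign bAlph` identification is typer-3's `MonadAlphabet` §3–§5 business, not re-done here.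
* ELABORATION NOTES (for successors): (i) the word finsets over `XWord` (`2¹⁶` words) are `irreducible_def`s — a reducible `Finset.univ.filter …` here
  makes every unification `_ ∈ diagXWords _` exhaust `maxRecDepth` (the unifier evaluates the finset); (ii) never hand a `Set.MapsTo ∕ BijOn` component on
  `↑(eFreeWordsOfDeg p)` to a `∀ a ∈ s, …` binder by defeq — convert with `Finset.mem_coe` (else `whnf` evaluates `Finset.univ : Finset CWord`, ~14 min).

## §3 Relation to the record

v4 (box frame): `WordFrame ∕ LinksTo ∕ classOf ∕ RealisesTensor ∕ Design.realisedBy_of_realisesTensor` — this file is their literal transcription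
through `MonadAlphabet` §7's dictionary, at tensor level (no `Design`), plus the scale device. v24 (unbuilt): `Tame ∕ CellTame ∕ cleanAtSeed_of_realisesTensor_tame
∕ WeilFrame.smulQ ∕ AnchorKit.atScale` on the BOX frame — the compound analogues here are new declarations with new names; when v24 builds, `F.overScale L hL`
and v24's `F.atScale L hL` agree extensionally (both `L⁻⁴·(r₁, r₂)`), unproved here since v24 cannot be imported. Namespace
`Summit.HodgeConjecture.HodgeConjecture.Cruxes.BlochSeedDiscOne.SeedChecker` (as v4–v24). No `instance`, no `notation`, no attribute games, no
`native_decide`, no `decide` over the `6⁴` ∕ `2¹⁶` word types (only over letter tables on `Fin 6`, `Finset (Fin 2)` pairs and `List (Fin 8)` literals), 0 `sorry`.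
-/

set_option linter.dupNamespace false

open CategoryTheory AlgebraicGeometry
open Literature.AlgebraicGeometry Literature.AlgebraicGeometry.Motives Literature.AlgebraicGeometry.HodgeTheory
open Literature.AlgebraicTopology.SingularHomology

noncomputable section

namespace Summit.HodgeConjecture.HodgeConjecture.Cruxes.BlochSeedDiscOne.SeedChecker

open Summit.HodgeConjecture.HodgeConjecture.Cruxes.BlochSeedDiscOne.Anchor
open Summit.Ventures.HSemireg Summit.Ventures.HSemireg.Pad4Tower
open Summit.HodgeConjecture.HodgeConjecture.Cruxes.BlochSeedDiscOne.MonadAlphabet (XWord I0 J0 eXWord ebarXWord oneXWord enum8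
  minor compoundCh XScreen NonboxLetter nonboxAlphabet fourierLetter fourier_probe)

/-! ## §25.1 Words of the compound frame: bidegree filters, diagonal ∕ off-diagonal words, reference diagonal words -/

section XWords

/-- the words `(I, J)` of bidegree `(k, k)` (`|I| = |J| = k`): the ones read in degree `k`. IRREDUCIBLE (use `mem_xwordsOfSize`): the finset is
a large closed term (a filter of the `2¹⁶` words) whose unfolding by `whnf` must be prevented (it exhausts the recursion budget). -/
irreducible_def xwordsOfSize (k : ℕ) : Finset XWord := Finset.univ.filter fun IJ => IJ.1.card = k ∧ IJ.2.card = k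

theorem mem_xwordsOfSize {k : ℕ} {IJ : XWord} : IJ ∈ xwordsOfSize k ↔ IJ.1.card = k ∧ IJ.2.card = k := by
  simp only [xwordsOfSize_def, Finset.mem_filter, Finset.mem_univ, true_and]

/-- the DIAGONAL words `(I, I)`, `|I| = k` — the compound frame's «e-free words of degree `k`» (`h^k ∕ k! = Σ_{|I| = k} (I;I)`). IRREDUCIBLE (use
`mem_diagXWords`). -/
irreducible_def diagXWords (k : ℕ) : Finset XWord := (xwordsOfSize k).filter fun IJ => IJ.1 = IJ.2

/-- the OFF-DIAGONAL words of bidegree `(k, k)` — the «e-mixed» words ((A1) kills all of them but the Weil pair `E, Ē` in size `4`). IRREDUCIBLE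
(use `mem_offDiagXWords`). -/
irreducible_def offDiagXWords (k : ℕ) : Finset XWord := (xwordsOfSize k).filter fun IJ => ¬ IJ.1 = IJ.2

theorem mem_diagXWords {k : ℕ} {IJ : XWord} : IJ ∈ diagXWords k ↔ (IJ.1.card = k ∧ IJ.2.card = k) ∧ IJ.1 = IJ.2 := by
  rw [diagXWords_def, Finset.mem_filter, mem_xwordsOfSize]

theorem mem_offDiagXWords {k : ℕ} {IJ : XWord} :
    IJ ∈ offDiagXWords k ↔ (IJ.1.card = k ∧ IJ.2.card = k) ∧ ¬ IJ.1 = IJ.2 := by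
  rw [offDiagXWords_def, Finset.mem_filter, mem_xwordsOfSize]

/-- `|I₀| = |J₀| = 4`, `I₀ ≠ J₀`, `E ≠ Ē`. [`decide`] -/
theorem card_I0_J0 : I0.card = 4 ∧ J0.card = 4 ∧ I0 ≠ J0 ∧ eXWord ≠ ebarXWord := by decide

theorem eXWord_mem_offDiagXWords : eXWord ∈ offDiagXWords 4 :=
  mem_offDiagXWords.2 ⟨⟨card_I0_J0.1, card_I0_J0.2.1⟩, card_I0_J0.2.2.1⟩

theorem ebarXWord_mem_offDiagXWords : ebarXWord ∈ offDiagXWords 4 :=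
  mem_offDiagXWords.2 ⟨⟨card_I0_J0.2.1, card_I0_J0.1⟩, fun h => card_I0_J0.2.2.1 h.symm⟩

/-- the reference coordinate set of size `k ≤ 8`: `{0, …, k − 1}`. -/
def xrefSet (k : ℕ) : Finset (Fin 8) := Finset.univ.filter fun i => (i : ℕ) < k

/-- the reference sets have the stated sizes. [`decide`] -/
theorem card_xrefSet : ∀ k : Fin 9, (xrefSet k).card = k := by decide

/-- the DIAGONAL COEFFICIENT `λ_k` of a tensor on the compound frame: its value on the reference diagonal word of size `k` (on a clean tensor every
diagonal word of size `k` carries it — `apply_diag_of_xScreen`; `λ₀` = rank, cf. `MonadDesign.rankX`). -/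
def xcoeff (T : XWord → GaussianInt) (k : ℕ) : GaussianInt := T (xrefSet k, xrefSet k)

theorem xcoeff_zero_eq (T : XWord → GaussianInt) : xcoeff T 0 = T oneXWord := by
  have h0 : xrefSet 0 = ∅ := by decide
  rw [xcoeff, h0]; rfl

variable {T : XWord → GaussianInt}

/-- on a clean tensor every diagonal word of size `k ≤ 8` carries `λ_k`. -/
theorem apply_diag_of_xScreen (hT : XScreen T) {k : Fin 9} {IJ : XWord} (hIJ : IJ ∈ diagXWords k) : T IJ = xcoeff T k := by
  obtain ⟨I, J⟩ := IJ
  obtain ⟨⟨hI, -⟩, hd⟩ := mem_diagXWords.1 hIJ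
  dsimp only at hI hd
  subst hd
  exact hT.2 I (xrefSet k) (hI.trans (card_xrefSet k).symm)

/-- on a clean tensor the off-diagonal words of size `k ≠ 4` vanish (the Weil pair has size `4`). -/
theorem apply_offDiag_of_xScreen (hT : XScreen T) {k : ℕ} (hk : k ≠ 4) {IJ : XWord} (hIJ : IJ ∈ offDiagXWords k) : T IJ = 0 := by
  obtain ⟨I, J⟩ := IJ
  obtain ⟨⟨hI, -⟩, hne⟩ := mem_offDiagXWords.1 hIJ
  dsimp only at hI hne
  refine hT.1 I J hne (fun h => hk ?_) (fun h => hk ?_)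
  · rw [← hI, (Prod.mk.inj h).1, card_I0_J0.1]
  · rw [← hI, (Prod.mk.inj h).1, card_I0_J0.2.1]

/-- … and in size `4` every off-diagonal word other than `E, Ē` vanishes. -/
theorem apply_offDiag_four_of_xScreen (hT : XScreen T) {IJ : XWord} (hIJ : IJ ∈ offDiagXWords 4)
    (hne : IJ ≠ eXWord ∧ IJ ≠ ebarXWord) : T IJ = 0 := by
  obtain ⟨I, J⟩ := IJ
  exact hT.1 I J (mem_offDiagXWords.1 hIJ).2 hne.1 hne.2

end XWords

/-! ## §25.2 The compound word frame (interface O-XF), its laws, the class a tensor names, the realisation sentences -/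

section XFrame

variable {E₀ : AbelianVariety ℂ} {ψ₀ : E₀ ⟶ E₀} {C : ChernCharacterBetti}

/-- **THE COMPOUND (EXTERIOR-ALGEBRA) WORD FRAME** of the anchor `S⁴ = pad4Anchor E₀` = `E₀⁸` (INTERFACE — an instance is the obligation O-XF, NOT
asserted here; design-independent, once per anchor): a class `xcls k (I, J) ∈ H^{2k}(S⁴(ℂ); ℂ)` for every word `(I, J)` of the compound frame and every
degree `k` (meaningful at `|I| = |J| = k`). DICTIONARY (`MonadAlphabet` §7 = semihom-2 §B): `xcls 1 ({j};{l})` = the class `dz_j·dz̄_l` normalised so that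
`c₁(L_M) = Σ_{j,l} M_{jl}·xcls 1 ({j};{l})` for `M ∈ Herm₈(ℤ[i])`, and `xcls k (I;J)` = the coefficient classes of `c₁(L_M)^k ∕ k! = Σ_{|I|=|J|=k} det M[I;J]·
xcls k (I;J)` (canonical: the `k×k` minors of a generic matrix are linearly independent). Only its LAWS (`XWordFrame.LinksTo`) are consumed. -/
structure XWordFrame (E₀ : AbelianVariety ℂ) where
  /-- the class of the word `(I, J)`, read in degree `k` -/
  xcls (k : ℕ) (IJ : XWord) : complexBetti (pad4Anchor E₀).X (2 * k)

/-- **THE COMPOUND FRAME IS LINKED TO THE FRAME `(h, r₁, r₂)`** (the laws of the dictionary, a `Prop`; part of O-XF): (XF1) `Σ_{|I| = k} xcls k (I;I)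
= h^k ∕ k!` for `k ≤ 8` — `h = h_std ↔ Id` and `det Id[I;J] = [I = J]`; (XF2) `r₁ = xcls₄ E + xcls₄ Ē`, `r₂ = i·(xcls₄ E − xcls₄ Ē)` with `E = (I₀;J₀)`,
`Ē = (J₀;I₀)` (the `WeilFrame` dictionary: `∧⁸` of the two `ψ`-eigenspaces `⟨dz_{2f}, dz̄_{2f+1}⟩`, `⟨dz_{2f+1}, dz̄_{2f}⟩` of `H¹(E₀⁸)`). -/
structure XWordFrame.LinksTo (Φ : XWordFrame E₀) (F : WeilFrame E₀ ψ₀) (h : complexBetti (pad4Anchor E₀).X 2) : Prop where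
  /-- (XF1) `h^k ∕ k!` is the sum of the diagonal words of size `k` -/
  sum_diag : ∀ k : Fin 9, ∑ IJ ∈ diagXWords k, Φ.xcls k IJ = (((k : ℕ).factorial : ℕ) : ℂ)⁻¹ • cupPowTwo h k
  /-- (XF2) `r₁ = E + Ē` -/
  rOne_eq : F.rOne = Φ.xcls 4 eXWord + Φ.xcls 4 ebarXWord
  /-- (XF2) `r₂ = i(E − Ē)` -/
  rTwo_eq : F.rTwo = Complex.I • (Φ.xcls 4 eXWord - Φ.xcls 4 ebarXWord)

/-- **THE CLASS A TENSOR NAMES** in degree `k`, read in the compound frame: `Σ_{|I| = |J| = k} T(I;J) · xcls k (I;J)`. -/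
def XWordFrame.classOf (Φ : XWordFrame E₀) (k : ℕ) (T : XWord → GaussianInt) : complexBetti (pad4Anchor E₀).X (2 * k) :=
  ∑ IJ ∈ xwordsOfSize k, GaussianInt.toComplex (T IJ) • Φ.xcls k IJ

/-- the class a tensor names splits as its diagonal part plus its off-diagonal part. -/
theorem XWordFrame.classOf_split (Φ : XWordFrame E₀) (k : ℕ) (T : XWord → GaussianInt) :
    Φ.classOf k T = ∑ IJ ∈ diagXWords k, GaussianInt.toComplex (T IJ) • Φ.xcls k IJ +
      ∑ IJ ∈ offDiagXWords k, GaussianInt.toComplex (T IJ) • Φ.xcls k IJ := by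
  rw [XWordFrame.classOf, diagXWords_def, offDiagXWords_def, Finset.sum_filter_add_sum_filter_not]

/-- **«THE SHEAF `𝓕` REALISES THE TENSOR `T`» on the compound frame** (through the Chern character theory `C` and the frame `Φ`): `ch_k(𝓕) =
Σ_{|I|=|J|=k} T(I;J)·xcls k (I;J)` for `k = 0, …, 8`. For a line bundle `L_M` and `T = compoundCh 1 M` this is the MODELLING SENTENCE «`ch(L_M) = exp c₁(L_M)`
in the frame» (obligation O-Xcells, per letter); for the class tensor of a design it is what the doors consume. -/
def XRealisesTensor (C : ChernCharacterBetti) (Φ : XWordFrame E₀) (𝓕 : (pad4Anchor E₀).X.left.Modules) (T : XWord → GaussianInt) : Prop :=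
  ∀ k : Fin 9, C.ch (pad4Anchor E₀).X 𝓕 k = Φ.classOf k T

/-- **realisation AT SCALE `L`**: `L^k · ch_k(𝓕) = classOf_k T` — the letters of one design carry slope NUMERATORS `M` at one common scale `L` (slope
`M ∕ L`; `ch_k(E_{M∕L}) = r·L^{-k}·∧^k M`), `MonadAlphabet` §7 critic τ1. -/
def XRealisesTensorAtScale (C : ChernCharacterBetti) (Φ : XWordFrame E₀) (𝓕 : (pad4Anchor E₀).X.left.Modules) (L : ℕ)
    (T : XWord → GaussianInt) : Prop :=
  ∀ k : Fin 9, ((L : ℂ) ^ (k : ℕ)) • C.ch (pad4Anchor E₀).X 𝓕 k = Φ.classOf k T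

theorem xRealisesTensorAtScale_one_iff {Φ : XWordFrame E₀} {𝓕 : (pad4Anchor E₀).X.left.Modules} {T : XWord → GaussianInt} :
    XRealisesTensorAtScale C Φ 𝓕 1 T ↔ XRealisesTensor C Φ 𝓕 T := by
  simp only [XRealisesTensorAtScale, XRealisesTensor, Nat.cast_one, one_pow, one_smul]

/-- isomorphic sheaves realise the same tensor (`ch_congr`). -/
theorem XRealisesTensorAtScale.congr_iso {Φ : XWordFrame E₀} {𝓕 𝓕' : (pad4Anchor E₀).X.left.Modules} {L : ℕ} {T : XWord → GaussianInt}
    (hT : XRealisesTensorAtScale C Φ 𝓕 L T) (e : 𝓕 ≅ 𝓕') : XRealisesTensorAtScale C Φ 𝓕' L T := fun k => by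
  rw [← C.ch_congr e k]; exact hT k

end XFrame

/-! ## §25.3 Tame tensors and THE TENSOR-LEVEL COLLAPSE on the compound frame: (A1) + tame + realisation ⟹ (A1)-clean AT THE SEED -/

section XCollapse

variable {E₀ : AbelianVariety ℂ} {ψ₀ : E₀ ⟶ E₀} {C : ChernCharacterBetti} {T : XWord → GaussianInt}

/-- **AN X-TAME TENSOR**: every diagonal entry is self-conjugate (real) and `T(Ē) = conj T(E)` — what Hermitian letters give for free (§25.4) and what
makes the `W`-part of the class RATIONAL (`T(E)·E + T(Ē)·Ē = Re μ·r₁ + Im μ·r₂`). -/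
structure XTame (T : XWord → GaussianInt) : Prop where
  /-- diagonal entries are self-conjugate -/
  diag : ∀ I : Finset (Fin 8), star (T (I, I)) = T (I, I)
  /-- the conjugate Weil word carries the conjugate coefficient -/
  ebar : T ebarXWord = star (T eXWord)

theorem im_eq_zero_of_star_self {z : GaussianInt} (h : star z = z) : z.im = 0 := by
  have h' := congrArg Zsqrtd.im h
  rw [Zsqrtd.im_star] at h'
  omega

theorem toComplex_eq_re_of_star_self {z : GaussianInt} (h : star z = z) : GaussianInt.toComplex z = ((z.re : ℤ) : ℂ) := by
  rw [GaussianInt.toComplex_def, im_eq_zero_of_star_self h, Int.cast_zero, zero_mul, add_zero]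

theorem XTame.star_xcoeff (hTt : XTame T) (k : ℕ) : star (xcoeff T k) = xcoeff T k := hTt.diag _

theorem XTame.zero : XTame (0 : XWord → GaussianInt) :=
  ⟨fun _ => star_zero _, by rw [Pi.zero_apply, Pi.zero_apply, star_zero]⟩

theorem XTame.add {T T' : XWord → GaussianInt} (hT : XTame T) (hT' : XTame T') : XTame (T + T') :=
  ⟨fun I => by rw [Pi.add_apply, star_add, hT.diag, hT'.diag], by rw [Pi.add_apply, Pi.add_apply, star_add, hT.ebar, hT'.ebar]⟩

theorem XTame.neg (hT : XTame T) : XTame (-T) :=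
  ⟨fun I => by rw [Pi.neg_apply, star_neg, hT.diag], by rw [Pi.neg_apply, Pi.neg_apply, star_neg, hT.ebar]⟩

theorem XTame.sub {T T' : XWord → GaussianInt} (hT : XTame T) (hT' : XTame T') : XTame (T - T') := by
  rw [sub_eq_add_neg]; exact hT.add hT'.neg

theorem XTame.zsmul (hT : XTame T) (n : ℤ) : XTame (n • T) :=
  ⟨fun I => by rw [Pi.smul_apply, star_zsmul, hT.diag], by rw [Pi.smul_apply, Pi.smul_apply, star_zsmul, hT.ebar]⟩

theorem XTame.sum {ι : Type*} (s : Finset ι) (f : ι → XWord → GaussianInt) (h : ∀ i ∈ s, XTame (f i)) :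
    XTame (∑ i ∈ s, f i) :=
  Finset.sum_induction f XTame (fun _ _ ha hb => ha.add hb) XTame.zero h

/-- the diagonal part of degree `k` of a clean tensor is `λ_k · Σ_{|I| = k} xcls k (I;I)`. -/
theorem sum_diag_smul_of_xScreen (hT : XScreen T) (Φ : XWordFrame E₀) (k : Fin 9) :
    ∑ IJ ∈ diagXWords k, GaussianInt.toComplex (T IJ) • Φ.xcls k IJ =
      GaussianInt.toComplex (xcoeff T k) • ∑ IJ ∈ diagXWords k, Φ.xcls k IJ := by
  rw [Finset.smul_sum]
  exact Finset.sum_congr rfl fun IJ hIJ => by rw [apply_diag_of_xScreen hT hIJ]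

/-- the off-diagonal part of a clean tensor vanishes in every degree `k ≠ 4`. -/
theorem sum_offDiag_eq_zero_of_xScreen (hT : XScreen T) (Φ : XWordFrame E₀) {k : ℕ} (hk : k ≠ 4) :
    ∑ IJ ∈ offDiagXWords k, GaussianInt.toComplex (T IJ) • Φ.xcls k IJ = 0 :=
  Finset.sum_eq_zero fun IJ hIJ => by rw [apply_offDiag_of_xScreen hT hk hIJ, map_zero, zero_smul]

/-- the off-diagonal part of degree `4` of a clean tensor is `T(E)·xcls₄ E + T(Ē)·xcls₄ Ē`. -/
theorem sum_offDiag_four_of_xScreen (hT : XScreen T) (Φ : XWordFrame E₀) :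
    ∑ IJ ∈ offDiagXWords 4, GaussianInt.toComplex (T IJ) • Φ.xcls 4 IJ =
      GaussianInt.toComplex (T eXWord) • Φ.xcls 4 eXWord + GaussianInt.toComplex (T ebarXWord) • Φ.xcls 4 ebarXWord :=
  Finset.sum_eq_add_of_mem eXWord ebarXWord eXWord_mem_offDiagXWords ebarXWord_mem_offDiagXWords card_I0_J0.2.2.2
    fun IJ hIJ hne => by rw [apply_offDiag_four_of_xScreen hT hIJ hne, map_zero, zero_smul]

/-- **(A1) + TAME ⟹ the class a tensor names is `(Re λ_k ∕ k!)·h^k` in degrees `k ≠ 4`.** -/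
theorem xClassOf_of_xScreen_ne_four {Φ : XWordFrame E₀} {F : WeilFrame E₀ ψ₀} {h : complexBetti (pad4Anchor E₀).X 2}
    (hΦ : Φ.LinksTo F h) (hT : XScreen T) (hTt : XTame T) (k : Fin 9) (hk : (k : ℕ) ≠ 4) :
    Φ.classOf k T = (((((xcoeff T k).re : ℤ) : ℚ) / ((k : ℕ).factorial : ℚ) : ℚ) : ℂ) • cupPowTwo h k := by
  rw [XWordFrame.classOf_split, sum_diag_smul_of_xScreen hT Φ k, hΦ.sum_diag k, sum_offDiag_eq_zero_of_xScreen hT Φ hk,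
    add_zero, smul_smul, toComplex_eq_re_of_star_self (hTt.star_xcoeff k)]
  congr 1
  push_cast
  ring

/-- **(A1) + TAME ⟹ the class a tensor names in degree `4` is `(Re λ₄ ∕ 24)·h⁴ + wOf T(E)`** (`T(Ē) = conj T(E)`, (XF2), and
`Re μ · r₁ + Im μ · r₂ = μ·E + μ̄·Ē`). -/
theorem xClassOf_of_xScreen_four {Φ : XWordFrame E₀} {F : WeilFrame E₀ ψ₀} {h : complexBetti (pad4Anchor E₀).X 2}
    (hΦ : Φ.LinksTo F h) (hT : XScreen T) (hTt : XTame T) :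
    Φ.classOf 4 T = (((((xcoeff T 4).re : ℤ) : ℚ) / 24 : ℚ) : ℂ) • cupPowTwo h 4 + F.wOf (T eXWord) := by
  have hdiag : ∑ IJ ∈ diagXWords 4, GaussianInt.toComplex (T IJ) • Φ.xcls 4 IJ =
      GaussianInt.toComplex (xcoeff T 4) • ∑ IJ ∈ diagXWords 4, Φ.xcls 4 IJ := sum_diag_smul_of_xScreen hT Φ 4
  have hF1 : ∑ IJ ∈ diagXWords 4, Φ.xcls 4 IJ = ((Nat.factorial 4 : ℕ) : ℂ)⁻¹ • cupPowTwo h 4 := hΦ.sum_diag 4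
  rw [XWordFrame.classOf_split, sum_offDiag_four_of_xScreen hT Φ, hdiag, hF1, toComplex_eq_re_of_star_self (hTt.star_xcoeff 4),
    hTt.ebar, GaussianInt.toComplex_star, WeilFrame.wOf, hΦ.rOne_eq, hΦ.rTwo_eq, GaussianInt.toComplex_def, smul_smul]
  simp only [map_add, map_mul, map_intCast, Complex.conj_I, Rat.cast_intCast, Rat.cast_div, Rat.cast_ofNat,
    show (Nat.factorial 4 : ℕ) = 24 from rfl, Nat.cast_ofNat]
  module

/-- **THE TENSOR-LEVEL COLLAPSE ON THE COMPOUND FRAME**: a sheaf realising a CLEAN TAME tensor `T` through a compound frame linked to `(F, h)` is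
(A1)-clean AT THE SEED (v4 `CleanAtSeed`) in every window `⊆ {0..8}`, `W`-coordinate the Weil minor `T(E)` — (A1@Z) ⟸ (A1) + tame + realisation. -/
theorem cleanAtSeed_of_xRealisesTensor {Φ : XWordFrame E₀} {F : WeilFrame E₀ ψ₀} {h : complexBetti (pad4Anchor E₀).X 2}
    {𝓔 : (pad4Anchor E₀).X.left.Modules} (hΦ : Φ.LinksTo F h) (hT : XScreen T) (hTt : XTame T) (hR : XRealisesTensor C Φ 𝓔 T)
    {I : Finset ℕ} (hI : ∀ p ∈ I, p ≤ 8) : CleanAtSeed C I F h 𝓔 (T eXWord) := by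
  refine ⟨fun p => if hp : p < 9 then (((xcoeff T p).re : ℤ) : ℚ) / ((p.factorial : ℕ) : ℚ) else 0,
    (((xcoeff T 4).re : ℤ) : ℚ) / 24, fun p hpI hp4 => ?_, (hR 4).trans (xClassOf_of_xScreen_four hΦ hT hTt)⟩
  have hp : p < 9 := Nat.lt_succ_of_le (hI p hpI)
  simp only [dif_pos hp]
  exact (hR ⟨p, hp⟩).trans (xClassOf_of_xScreen_ne_four hΦ hT hTt ⟨p, hp⟩ hp4)

/-! ### Frames read over a scale -/

/-- **THE WEIL FRAME READ OVER THE SCALE `L`**: `(r₁, r₂) ↦ (L⁻⁴·r₁, L⁻⁴·r₂)` — still rational, in the Weil plane, `ℂ`-independent; `wOf` divides by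
`L⁴` (`wOf_overScale`). (The box-frame twin is v24's `WeilFrame.atScale`, unbuilt; new name, no clash.) -/
def WeilFrame.overScale (F : WeilFrame E₀ ψ₀) (L : ℕ) (hL : L ≠ 0) : WeilFrame E₀ ψ₀ where
  rOne := ((((L : ℚ) ^ 4)⁻¹ : ℚ) : ℂ) • F.rOne
  rTwo := ((((L : ℚ) ^ 4)⁻¹ : ℚ) : ℂ) • F.rTwo
  rOne_rational := F.rOne_rational.smul _
  rTwo_rational := F.rTwo_rational.smul _
  rOne_mem := Submodule.smul_mem _ _ F.rOne_mem
  rTwo_mem := Submodule.smul_mem _ _ F.rTwo_mem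
  indep s t hst := by
    have hL' : (L : ℚ) ≠ 0 := Nat.cast_ne_zero.2 hL
    have hc : ((((L : ℚ) ^ 4)⁻¹ : ℚ) : ℂ) ≠ 0 := Rat.cast_ne_zero.2 (inv_ne_zero (pow_ne_zero 4 hL'))
    rw [smul_smul, smul_smul] at hst
    obtain ⟨hs, ht⟩ := F.indep _ _ hst
    exact ⟨(mul_eq_zero.1 hs).resolve_right hc, (mul_eq_zero.1 ht).resolve_right hc⟩

@[simp] theorem WeilFrame.overScale_rOne (F : WeilFrame E₀ ψ₀) (L : ℕ) (hL : L ≠ 0) :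
    (F.overScale L hL).rOne = ((((L : ℚ) ^ 4)⁻¹ : ℚ) : ℂ) • F.rOne := rfl

@[simp] theorem WeilFrame.overScale_rTwo (F : WeilFrame E₀ ψ₀) (L : ℕ) (hL : L ≠ 0) :
    (F.overScale L hL).rTwo = ((((L : ℚ) ^ 4)⁻¹ : ℚ) : ℂ) • F.rTwo := rfl

theorem WeilFrame.wOf_overScale (F : WeilFrame E₀ ψ₀) (L : ℕ) (hL : L ≠ 0) (μ : GaussianInt) :
    (F.overScale L hL).wOf μ = ((L : ℂ) ^ 4)⁻¹ • F.wOf μ := by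
  simp only [WeilFrame.wOf, WeilFrame.overScale_rOne, WeilFrame.overScale_rTwo, smul_smul, smul_add, Rat.cast_inv, Rat.cast_pow,
    Rat.cast_natCast]
  module

/-- **THE ANCHOR KIT READ OVER THE SCALE `L`**: same `η`, polarisation datum and hyperbolicity; Weil frame over the scale. -/
def AnchorKit.overScale (K : AnchorKit E₀ ψ₀) (L : ℕ) (hL : L ≠ 0) : AnchorKit E₀ ψ₀ :=
  ⟨K.η, K.η_rational, K.η_ne_zero, K.F.overScale L hL, K.pol, K.hyperbolic⟩

@[simp] theorem AnchorKit.overScale_F (K : AnchorKit E₀ ψ₀) (L : ℕ) (hL : L ≠ 0) : (K.overScale L hL).F = K.F.overScale L hL := rfl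

@[simp] theorem AnchorKit.overScale_η (K : AnchorKit E₀ ψ₀) (L : ℕ) (hL : L ≠ 0) : (K.overScale L hL).η = K.η := rfl

@[simp] theorem AnchorKit.overScale_pol (K : AnchorKit E₀ ψ₀) (L : ℕ) (hL : L ≠ 0) : (K.overScale L hL).pol = K.pol := rfl

/-- **THE COLLAPSE AT SCALE `L`**: realised at scale `L` ⟹ (A1)-clean at the seed against `h` itself and the Weil frame read over the scale. -/
theorem cleanAtSeed_overScale_of_xRealisesTensorAtScale {Φ : XWordFrame E₀} {F : WeilFrame E₀ ψ₀}
    {h : complexBetti (pad4Anchor E₀).X 2} {𝓔 : (pad4Anchor E₀).X.left.Modules} {L : ℕ} (hL : L ≠ 0) (hΦ : Φ.LinksTo F h)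
    (hT : XScreen T) (hTt : XTame T) (hR : XRealisesTensorAtScale C Φ 𝓔 L T) {I : Finset ℕ} (hI : ∀ p ∈ I, p ≤ 8) :
    CleanAtSeed C I (F.overScale L hL) h 𝓔 (T eXWord) := by
  have hLC : ∀ p : ℕ, ((L : ℂ) ^ p) ≠ 0 := fun p => pow_ne_zero _ (Nat.cast_ne_zero.2 hL)
  have key : ∀ (p : ℕ) (x : ℚ), ((L : ℂ) ^ p)⁻¹ • ((x : ℚ) : ℂ) • cupPowTwo h p = (((x / (L : ℚ) ^ p : ℚ)) : ℂ) • cupPowTwo h p := by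
    intro p x
    rw [smul_smul, Rat.cast_div, Rat.cast_pow, Rat.cast_natCast, div_eq_inv_mul]
  refine ⟨fun p => if hp : p < 9 then (((xcoeff T p).re : ℤ) : ℚ) / ((p.factorial : ℕ) : ℚ) / (L : ℚ) ^ p else 0,
    (((xcoeff T 4).re : ℤ) : ℚ) / 24 / (L : ℚ) ^ 4, fun p hpI hp4 => ?_, ?_⟩
  · have hp : p < 9 := Nat.lt_succ_of_le (hI p hpI)
    simp only [dif_pos hp]
    have e := (eq_inv_smul_iff₀ (hLC p)).2 ((hR ⟨p, hp⟩).trans (xClassOf_of_xScreen_ne_four hΦ hT hTt ⟨p, hp⟩ hp4))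
    rw [key] at e
    exact e
  · rw [WeilFrame.wOf_overScale]
    have e := (eq_inv_smul_iff₀ (hLC 4)).2 ((hR 4).trans (xClassOf_of_xScreen_four hΦ hT hTt))
    rw [smul_add, key] at e
    exact e

end XCollapse

/-! ## §25.4 Hermitian letters are tame: `det Mᴴ[J;I] = conj det M[I;J]`; tameness of class tensors of designs with Hermitian cells -/

section Herm

/-- **minors of the conjugate transpose**: `det Mᴴ[J;I] = conj det M[I;J]` (`det_conjTranspose`, re-indexing the square submatrix along the cast
`Fin |J| ≃ Fin |I|`). -/
theorem minor_conjTranspose_swap (M : Matrix (Fin 8) (Fin 8) GaussianInt) (I J : Finset (Fin 8)) :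
    minor M.conjTranspose J I = star (minor M I J) := by
  unfold minor
  by_cases hlen : (enum8 J).length = (enum8 I).length
  · rw [dif_pos hlen, dif_pos hlen.symm, ← Matrix.det_conjTranspose, Matrix.conjTranspose_submatrix,
      ← Matrix.det_submatrix_equiv_self (finCongr hlen)]
    rfl
  · rw [dif_neg hlen, dif_neg (fun h => hlen h.symm), star_zero]

/-- for a Hermitian numerator, `det M[J;I] = conj det M[I;J]`. -/
theorem minor_swap_of_isHerm {x : NonboxLetter} (hx : x.IsHerm) (I J : Finset (Fin 8)) : minor x.M J I = star (minor x.M I J) := by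
  have hM : x.M.conjTranspose = x.M := hx
  have h := minor_conjTranspose_swap x.M I J
  rwa [hM] at h

/-- **THE CLASS TENSOR OF A HERMITIAN NON-BOX LETTER IS X-TAME** (principal minors real; `det M[J₀;I₀] = conj det M[I₀;J₀]`; any rank weight `r`). -/
theorem xTame_compoundCh_of_isHerm {x : NonboxLetter} (hx : x.IsHerm) (r : ℕ) : XTame (compoundCh r x.M) where
  diag I := by
    show star ((r : GaussianInt) * minor x.M I I) = (r : GaussianInt) * minor x.M I I
    rw [star_mul', star_natCast, ← minor_swap_of_isHerm hx I I]
  ebar := by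
    show (r : GaussianInt) * minor x.M J0 I0 = star ((r : GaussianInt) * minor x.M I0 J0)
    rw [star_mul', star_natCast, minor_swap_of_isHerm hx I0 J0]

variable {𝔠 : MonadAlphabet.CellAlphabet GaussianInt XWord}

/-- a monad design whose listed cells have tame class tensors has a tame class tensor. -/
theorem xTame_wch_monad (D : MonadAlphabet.MonadDesign 𝔠) (hA : ∀ Z ∈ D.A, XTame (𝔠.ch Z)) (hN : ∀ Z ∈ D.N, XTame (𝔠.ch Z))
    (hC : ∀ Z ∈ D.C, XTame (𝔠.ch Z)) : XTame D.wch :=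
  ((XTame.sum _ _ fun Z hZ => (hN Z hZ).zsmul _).sub (XTame.sum _ _ fun Z hZ => (hA Z hZ).zsmul _)).sub
    (XTame.sum _ _ fun Z hZ => (hC Z hZ).zsmul _)

/-- a two-term presentation whose listed cells have tame class tensors has a tame class tensor. -/
theorem xTame_wch_pres (Pr : MonadAlphabet.Presentation 𝔠) (hN : ∀ Z ∈ Pr.N, XTame (𝔠.ch Z)) (hP : ∀ Z ∈ Pr.P, XTame (𝔠.ch Z)) :
    XTame Pr.wch :=
  (XTame.sum _ _ fun Z hZ => (hN Z hZ).zsmul _).sub (XTame.sum _ _ fun Z hZ => (hP Z hZ).zsmul _)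

/-- **json-side check «all listed cells are Hermitian»** for a monad design over the non-box alphabet (decidable per design; `NonboxLetter` carries
`IsHerm` as a predicate, not a field, so the checker must ask). -/
def AllHermMonad (D : MonadAlphabet.MonadDesign nonboxAlphabet) : Prop :=
  (∀ Z ∈ D.A, NonboxLetter.IsHerm Z) ∧ (∀ Z ∈ D.N, NonboxLetter.IsHerm Z) ∧ ∀ Z ∈ D.C, NonboxLetter.IsHerm Z

/-- the same for a two-term presentation over the non-box alphabet. -/
def AllHermPres (Pr : MonadAlphabet.Presentation nonboxAlphabet) : Prop :=
  (∀ Z ∈ Pr.N, NonboxLetter.IsHerm Z) ∧ ∀ Z ∈ Pr.P, NonboxLetter.IsHerm Z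

/-- **monad designs over the non-box alphabet with Hermitian cells have X-tame class tensors.** -/
theorem xTame_wch_of_allHermMonad (D : MonadAlphabet.MonadDesign nonboxAlphabet) (hD : AllHermMonad D) : XTame D.wch :=
  xTame_wch_monad D (fun Z hZ => xTame_compoundCh_of_isHerm (hD.1 Z hZ) _) (fun Z hZ => xTame_compoundCh_of_isHerm (hD.2.1 Z hZ) _)
    fun Z hZ => xTame_compoundCh_of_isHerm (hD.2.2 Z hZ) _

/-- presentations likewise. -/
theorem xTame_wch_of_allHermPres (Pr : MonadAlphabet.Presentation nonboxAlphabet) (hPr : AllHermPres Pr) : XTame Pr.wch :=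
  xTame_wch_pres Pr (fun Z hZ => xTame_compoundCh_of_isHerm (hPr.1 Z hZ) _) fun Z hZ => xTame_compoundCh_of_isHerm (hPr.2 Z hZ) _

end Herm

/-! ## §25.5 The doors on the compound frame: tensor level (any alphabet on `XWord`) and by name for `nonboxAlphabet` -/

section XDoors

variable {E₀ : AbelianVariety ℂ} {ψ₀ : E₀ ⟶ E₀} {C : ChernCharacterBetti}

/-- **THE COMPOUND WORD KIT** of the anchor `(E₀, ψ₀)`: anchor kit (O-W, O-pol, O-hyp) + compound frame linked to `(F, h_std)` (O-XF). A structure,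
i.e. DATA: nothing asserts that one exists. -/
structure XWordKit (E₀ : AbelianVariety ℂ) (ψ₀ : E₀ ⟶ E₀) where
  /-- O-W, O-pol, O-hyp -/
  kit : AnchorKit E₀ ψ₀
  /-- O-XF -/
  Φ : XWordFrame E₀
  links : Φ.LinksTo kit.F (hStd E₀ kit.η)

/-- **THE SHEAF DOOR ON THE COMPOUND FRAME, TENSOR LEVEL, ANY ALPHABET**: a clean (`XScreen`), tame tensor with Weil minor `T(E) ≠ 0`, realised at scale
`L` by a finite locally free `I`-semiregular `𝓔` (`4 ∈ I ⊆ {0..8}`) ⟹ the tree's `HasHyperbolicBFSheafSeedOn C 4 1 I` (v5's kit-level door on the kit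
read over the scale). The H2-type hypothesis `hsr` and the realisation sentence `hR` are the whole content. -/
theorem hasHyperbolicBFSheafSeedOn_of_xTensor (hE : E₀.dim = 1) (hψ : ψ₀ ≫ ψ₀ = -(1 • 𝟙 E₀)) (W : XWordKit E₀ ψ₀)
    {T : XWord → GaussianInt} (hT : XScreen T) (hTt : XTame T) (hμ : T eXWord ≠ 0) {L : ℕ} (hL : L ≠ 0)
    {𝓔 : (pad4Anchor E₀).X.left.Modules} (hR : XRealisesTensorAtScale C W.Φ 𝓔 L T) {I : Finset ℕ} (h4 : 4 ∈ I)
    (hI : ∀ p ∈ I, p ≤ 8) (h𝓔 : IsFiniteLocallyFree 𝓔) (hsr : IsISemiregular h𝓔 {q' | q' + 1 ∈ I}) :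
    HasHyperbolicBFSheafSeedOn C 4 1 I :=
  hasHyperbolicBFSheafSeedOn_of_cleanAtSeed hE hψ (W.kit.overScale L hL) hμ h𝓔 h4 hsr
    (cleanAtSeed_overScale_of_xRealisesTensorAtScale hL W.links hT hTt hR hI)

/-- **(σ) OBJECT HALF ON THE COMPOUND FRAME FROM A ZERO SCHEME, AT SCALE `L`** (lci door, GIVEN v4's law `TopChernFourLocalisation`): a rank-`4` bundle
`𝓕` realising a clean tame tensor with `T(E) ≠ 0` and the zero scheme `i : Z ↪ S⁴` of a section ⟹ `∃ q, ClassCheck (K.overScale L) T(E) i q`. -/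
theorem classCheck_of_xTensor_zeroScheme (hE : E₀.dim = 1) (hψ : ψ₀ ≫ ψ₀ = -(1 • 𝟙 E₀)) (W : XWordKit E₀ ψ₀)
    {T : XWord → GaussianInt} (hT : XScreen T) (hTt : XTame T) (hμ : T eXWord ≠ 0) {L : ℕ} (hL : L ≠ 0)
    {𝓕 : (pad4Anchor E₀).X.left.Modules} (hloc : TopChernFourLocalisation C) (hrk : HasRank 𝓕 4)
    (hR : XRealisesTensorAtScale C W.Φ 𝓕 L T) (s : Modules.unitModule (pad4Anchor E₀).X.left ⟶ 𝓕) {Z : Scheme.{0}}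
    {i : Z ⟶ (pad4Anchor E₀).X.left} (hZ : IsZeroSchemeOf s i) : ∃ q : ℚ, ClassCheck (W.kit.overScale L hL) (T eXWord) i q := by
  obtain ⟨q, hq⟩ := supported_symH_of_zeroScheme hE hψ (W.kit.overScale L hL) hloc hrk
    (cleanAtSeed_overScale_of_xRealisesTensorAtScale hL W.links hT hTt hR le_eight_of_mem_koszulWindow)
    one_two_three_mem_koszulWindow.1 one_two_three_mem_koszulWindow.2.1 one_two_three_mem_koszulWindow.2.2 s hZ
  exact ⟨q, hμ, hq⟩

/-- a class check (σ) plus C5–C7 of the presented subscheme IS a v4 `SeedCertificate` (which `seedData_of_certificate` ∕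
`blochSeedDiscOne_of_certificates` consume unchanged). Pure packaging. -/
def SeedCertificate.ofClassCheck (K : AnchorKit E₀ ψ₀) {μ : GaussianInt} {Z : Scheme.{0}} {i : Z ⟶ (pad4Anchor E₀).X.left}
    {q : ℚ} (hcc : ClassCheck K μ i q) (hci : IsClosedImmersion i) (hreg : IsRegularImmersionOfCodim i 4)
    (hint : AlgebraicGeometry.IsIntegral Z) (hcoh : ∀ z ∈ Set.range i.base, ((4 : ℕ) : ℕ∞) ≤ Order.coheight z)
    (hsr : IsBlochSemiregular i (2 * 4) 4) : SeedCertificate E₀ ψ₀ :=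
  ⟨K, μ, hcc.1, Z, i, q, hci, hreg, hint, hcoh, hsr, hcc.2⟩

/-- **THE SHEAF-SEED CHECKER FOR A MONAD DESIGN OVER THE NON-BOX ALPHABET, END TO END**: (A1) on the compound frame (`CleanX`), Hermitian cells,
Weil minor `muX ≠ 0`, the cohomology bundle `𝓔` realising the design's class tensor at scale `L`, finite locally free and `I`-semiregular ⟹
`HasHyperbolicBFSheafSeedOn C 4 1 I`. -/
theorem hasHyperbolicBFSheafSeedOn_of_nonboxMonadDesign (hE : E₀.dim = 1) (hψ : ψ₀ ≫ ψ₀ = -(1 • 𝟙 E₀)) (W : XWordKit E₀ ψ₀)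
    (D : MonadAlphabet.MonadDesign nonboxAlphabet) (hherm : AllHermMonad D) (hclean : D.CleanX) (hμ : D.muX ≠ 0) {L : ℕ}
    (hL : L ≠ 0) {𝓔 : (pad4Anchor E₀).X.left.Modules} (hR : XRealisesTensorAtScale C W.Φ 𝓔 L D.wch) {I : Finset ℕ} (h4 : 4 ∈ I)
    (hI : ∀ p ∈ I, p ≤ 8) (h𝓔 : IsFiniteLocallyFree 𝓔) (hsr : IsISemiregular h𝓔 {q' | q' + 1 ∈ I}) :
    HasHyperbolicBFSheafSeedOn C 4 1 I :=
  hasHyperbolicBFSheafSeedOn_of_xTensor hE hψ W hclean (xTame_wch_of_allHermMonad D hherm) hμ hL hR h4 hI h𝓔 hsr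

/-- … for a two-term presentation over the non-box alphabet (kernel or cokernel reading: same class tensor). -/
theorem hasHyperbolicBFSheafSeedOn_of_nonboxPresentation (hE : E₀.dim = 1) (hψ : ψ₀ ≫ ψ₀ = -(1 • 𝟙 E₀)) (W : XWordKit E₀ ψ₀)
    (Pr : MonadAlphabet.Presentation nonboxAlphabet) (hherm : AllHermPres Pr) (hclean : XScreen Pr.wch) (hμ : Pr.wch eXWord ≠ 0)
    {L : ℕ} (hL : L ≠ 0) {𝓔 : (pad4Anchor E₀).X.left.Modules} (hR : XRealisesTensorAtScale C W.Φ 𝓔 L Pr.wch) {I : Finset ℕ}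
    (h4 : 4 ∈ I) (hI : ∀ p ∈ I, p ≤ 8) (h𝓔 : IsFiniteLocallyFree 𝓔) (hsr : IsISemiregular h𝓔 {q' | q' + 1 ∈ I}) :
    HasHyperbolicBFSheafSeedOn C 4 1 I :=
  hasHyperbolicBFSheafSeedOn_of_xTensor hE hψ W hclean (xTame_wch_of_allHermPres Pr hherm) hμ hL hR h4 hI h𝓔 hsr

/-- **(σ) OBJECT HALF FOR A MONAD DESIGN OVER THE NON-BOX ALPHABET FROM A ZERO SCHEME, AT SCALE `L`** (GIVEN the law). -/
theorem classCheck_of_nonboxMonadDesign_zeroScheme (hE : E₀.dim = 1) (hψ : ψ₀ ≫ ψ₀ = -(1 • 𝟙 E₀)) (W : XWordKit E₀ ψ₀)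
    (D : MonadAlphabet.MonadDesign nonboxAlphabet) (hherm : AllHermMonad D) (hclean : D.CleanX) (hμ : D.muX ≠ 0) {L : ℕ}
    (hL : L ≠ 0) {𝓕 : (pad4Anchor E₀).X.left.Modules} (hloc : TopChernFourLocalisation C) (hrk : HasRank 𝓕 4)
    (hR : XRealisesTensorAtScale C W.Φ 𝓕 L D.wch) (s : Modules.unitModule (pad4Anchor E₀).X.left ⟶ 𝓕) {Z : Scheme.{0}}
    {i : Z ⟶ (pad4Anchor E₀).X.left} (hZ : IsZeroSchemeOf s i) : ∃ q : ℚ, ClassCheck (W.kit.overScale L hL) D.muX i q :=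
  classCheck_of_xTensor_zeroScheme hE hψ W hclean (xTame_wch_of_allHermMonad D hherm) hμ hL hloc hrk hR s hZ

end XDoors

/-! ## §25.6 Kernel probe: the screen has teeth on the compound frame -/

section XProbes

/-- **semihom-2 §C's Fourier letter ALONE is X-tame (Hermitian) but NOT clean**: its off-diagonal `1×1` minor `det F[{0};{1}] = (F₄)₀₀ = 1 ≠ 0` sits off the
Weil pair (a single non-box line bundle has `c₁ ∉ ℚ·h`; semihom-2's designs symmetrise under `Γ₀` first). [`decide` on the `1×1` minor] -/
theorem fourier_xTame_not_cleanX :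
    XTame (nonboxAlphabet.ch fourierLetter) ∧ ¬ XScreen (nonboxAlphabet.ch fourierLetter) := by
  refine ⟨xTame_compoundCh_of_isHerm fourier_probe.1 _, fun h => ?_⟩
  have h01 : nonboxAlphabet.ch fourierLetter (({0} : Finset (Fin 8)), ({1} : Finset (Fin 8))) = 1 := by decide
  have hne : ({0} : Finset (Fin 8)) ≠ {1} := by decide
  have hE : ((({0} : Finset (Fin 8)), ({1} : Finset (Fin 8))) : XWord) ≠ (I0, J0) := by decide
  have hEb : ((({0} : Finset (Fin 8)), ({1} : Finset (Fin 8))) : XWord) ≠ (J0, I0) := by decide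
  exact one_ne_zero (h01.symm.trans (h.1 {0} {1} hne hE hEb))

/-- the Fourier letter's Weil minor is non-zero (`μ = −16·i`, `MonadAlphabet.fourier_probe`): its (σ) design half passes, its (A1) fails. -/
theorem fourier_muX_ne_zero : nonboxAlphabet.ch fourierLetter eXWord ≠ 0 := by
  have h : nonboxAlphabet.ch fourierLetter eXWord = ⟨0, -16⟩ := by
    show ((1 : ℕ) : GaussianInt) * minor fourierLetter.M I0 J0 = ⟨0, -16⟩
    rw [fourier_probe.2.2.1, Nat.cast_one, one_mul]
  rw [h]; decide

end XProbes


/-! ## §25.7 The box restriction: box words inside the compound frame (one frame serves both alphabets) -/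

section BoxRestriction

variable {E₀ : AbelianVariety ℂ} {ψ₀ : E₀ ⟶ E₀}

/-- the `dz`-part of a letter on one factor, in local coordinates (`0 ↦ z_{2f}`, `1 ↦ z_{2f+1}`): `1, u, v, e, ē, p ↦ ∅, {0}, {1}, {0}, {1}, {0,1}`. -/
def zLoc : Fin 6 → Finset (Fin 2) := ![∅, {0}, {1}, {0}, {1}, {0, 1}]

/-- the `dz̄`-part of a letter: `1, u, v, e, ē, p ↦ ∅, {0}, {1}, {1}, {0}, {0,1}` (`e_f = dz_{2f}·dz̄_{2f+1}`, `ē_f = dz_{2f+1}·dz̄_{2f}`). -/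
def zbarLoc : Fin 6 → Finset (Fin 2) := ![∅, {0}, {1}, {1}, {0}, {0, 1}]

/-- the global coordinate `2f + b` of the local coordinate `b` on factor `f`. -/
def slot (f : Fin 4) (b : Fin 2) : Fin 8 := ⟨2 * (f : ℕ) + b, by omega⟩

/-- **THE DICTIONARY box word ↦ compound word** (`MonadAlphabet` §7 ∕ semihom-2 §B: `1 ↦ (∅;∅)`, `u_f ↦ ({2f};{2f})`, `v_f ↦ ({2f+1};{2f+1})`,
`e_f ↦ ({2f};{2f+1})`, `ē_f ↦ ({2f+1};{2f})`, `p_f ↦ ({2f,2f+1};{2f,2f+1})`; union over the four factors). -/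
def xwOf (w : CWord) : XWord :=
  (Finset.univ.biUnion fun f => (zLoc (w f)).image (slot f), Finset.univ.biUnion fun f => (zbarLoc (w f)).image (slot f))

/-- `eeee ↦ E`, `ēēēē ↦ Ē`, `1111 ↦ (∅;∅)`, `pppp ↦ ({0..7};{0..7})`. [`decide`] -/
theorem xwOf_eWord : xwOf eWord = eXWord ∧ xwOf ebarWord = ebarXWord ∧ xwOf ![0, 0, 0, 0] = oneXWord ∧
    xwOf ![5, 5, 5, 5] = (Finset.univ, Finset.univ) := by
  decide

/-- letter table: both parts of a letter have `ldeg` elements. [`decide`] -/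
theorem card_zLoc : ∀ l : Fin 6, (zLoc l).card = ldeg l ∧ (zbarLoc l).card = ldeg l := by decide

/-- letter table: e-free letters have equal `dz`- and `dz̄`-parts. [`decide`] -/
theorem zLoc_eq_zbarLoc : ∀ l : Fin 6, l ≠ 3 → l ≠ 4 → zLoc l = zbarLoc l := by decide

/-- letter table: on e-free letters the `dz`-part determines the letter. [`decide`] -/
theorem zLoc_inj : ∀ l l' : Fin 6, l ≠ 3 → l ≠ 4 → l' ≠ 3 → l' ≠ 4 → zLoc l = zLoc l' → l = l' := by decide

theorem slot_inj {f f' : Fin 4} {b b' : Fin 2} (h : slot f b = slot f' b') : f = f' ∧ b = b' := by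
  have hv := congrArg Fin.val h
  have hb := b.isLt; have hb' := b'.isLt
  dsimp only [slot] at hv
  exact ⟨Fin.ext (by omega), Fin.ext (by omega)⟩

theorem slot_injective (f : Fin 4) : Function.Injective (slot f) := fun _ _ h => (slot_inj h).2

/-- every global coordinate is a slot. [`decide`] -/
theorem exists_slot_eq : ∀ i : Fin 8, ∃ f : Fin 4, ∃ b : Fin 2, slot f b = i := by decide

theorem disjoint_slot_image {f f' : Fin 4} (hff : f ≠ f') (A B : Finset (Fin 2)) : Disjoint (A.image (slot f)) (B.image (slot f')) :=
  Finset.disjoint_left.2 fun x hx hx' => by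
    obtain ⟨b, -, rfl⟩ := Finset.mem_image.1 hx
    obtain ⟨b', -, h⟩ := Finset.mem_image.1 hx'
    exact hff (slot_inj h).1.symm

/-- local coordinate `b` of factor `f` lies in the `dz`-part of `xwOf w` iff it lies in the `dz`-part of the letter `w f`. -/
theorem slot_mem_xwOf_fst {w : CWord} {f : Fin 4} {b : Fin 2} : slot f b ∈ (xwOf w).1 ↔ b ∈ zLoc (w f) := by
  constructor
  · intro h
    obtain ⟨f', -, hf'⟩ := Finset.mem_biUnion.1 h
    obtain ⟨b', hb', he⟩ := Finset.mem_image.1 hf'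
    obtain ⟨rfl, rfl⟩ := slot_inj he
    exact hb'
  · intro h
    exact Finset.mem_biUnion.2 ⟨f, Finset.mem_univ _, Finset.mem_image.2 ⟨b, h, rfl⟩⟩

/-- the `dz`-part of `xwOf w` has `wdeg w` elements (letter parts are disjoint across factors and have `ldeg` elements). -/
theorem card_xwOf_fst (w : CWord) : (xwOf w).1.card = wdeg w := by
  have hdisj : (↑(Finset.univ : Finset (Fin 4)) : Set (Fin 4)).PairwiseDisjoint fun f => (zLoc (w f)).image (slot f) :=
    fun f _ f' _ hff => disjoint_slot_image hff _ _
  show (Finset.univ.biUnion fun f => (zLoc (w f)).image (slot f)).card = wdeg w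
  rw [Finset.card_biUnion hdisj]
  simp only [Finset.card_image_of_injective _ (slot_injective _), (card_zLoc _).1, Fin.sum_univ_four, wdeg]

theorem card_xwOf_snd (w : CWord) : (xwOf w).2.card = wdeg w := by
  have hdisj : (↑(Finset.univ : Finset (Fin 4)) : Set (Fin 4)).PairwiseDisjoint fun f => (zbarLoc (w f)).image (slot f) :=
    fun f _ f' _ hff => disjoint_slot_image hff _ _
  show (Finset.univ.biUnion fun f => (zbarLoc (w f)).image (slot f)).card = wdeg w
  rw [Finset.card_biUnion hdisj]
  simp only [Finset.card_image_of_injective _ (slot_injective _), (card_zLoc _).2, Fin.sum_univ_four, wdeg]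

/-- an e-free word goes to a DIAGONAL compound word. -/
theorem xwOf_fst_eq_snd {w : CWord} (hw : EFree w) : (xwOf w).1 = (xwOf w).2 :=
  Finset.biUnion_congr rfl fun f _ => by rw [zLoc_eq_zbarLoc (w f) (hw f).1 (hw f).2]

/-- the dictionary is injective on e-free words. -/
theorem xwOf_injOn_eFree {w w' : CWord} (hw : EFree w) (hw' : EFree w') (h : xwOf w = xwOf w') : w = w' := by
  funext f
  refine zLoc_inj (w f) (w' f) (hw f).1 (hw f).2 (hw' f).1 (hw' f).2 (Finset.ext fun b => ?_)
  rw [← slot_mem_xwOf_fst, ← slot_mem_xwOf_fst, h]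

/-- the e-free box word READING a coordinate set: factor `f` carries `1, u, v, p` according as `{2f, 2f+1} ∩ I = ∅, {2f}, {2f+1}, {2f, 2f+1}`. -/
def wOfX (I : Finset (Fin 8)) : CWord := fun f =>
  if slot f 0 ∈ I then (if slot f 1 ∈ I then 5 else 1) else (if slot f 1 ∈ I then 2 else 0)

theorem eFree_wOfX (I : Finset (Fin 8)) : EFree (wOfX I) := fun f => by
  unfold wOfX; split_ifs <;> decide

theorem mem_zLoc_wOfX {I : Finset (Fin 8)} {f : Fin 4} {b : Fin 2} : b ∈ zLoc (wOfX I f) ↔ slot f b ∈ I := by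
  have ht : zLoc 0 = ∅ ∧ zLoc 1 = {0} ∧ zLoc 2 = {1} ∧ zLoc 5 = {0, 1} := by decide
  have hb : b = 0 ∨ b = 1 := by fin_cases b <;> simp
  unfold wOfX
  rcases hb with rfl | rfl <;> by_cases h0 : slot f 0 ∈ I <;> by_cases h1 : slot f 1 ∈ I <;>
    simp only [h0, h1, if_true, if_false, ht.1, ht.2.1, ht.2.2.1, ht.2.2.2, Finset.mem_insert, Finset.mem_singleton,
      Finset.notMem_empty] <;> decide

/-- reading then writing returns the coordinate set. -/
theorem xwOf_wOfX_fst (I : Finset (Fin 8)) : (xwOf (wOfX I)).1 = I := by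
  ext i
  obtain ⟨f, b, rfl⟩ := exists_slot_eq i
  rw [slot_mem_xwOf_fst, mem_zLoc_wOfX]

theorem xwOf_wOfX (I : Finset (Fin 8)) : xwOf (wOfX I) = (I, I) :=
  Prod.ext (xwOf_wOfX_fst I) ((xwOf_fst_eq_snd (eFree_wOfX I)).symm.trans (xwOf_wOfX_fst I))

theorem wdeg_wOfX (I : Finset (Fin 8)) : wdeg (wOfX I) = I.card := by
  rw [← card_xwOf_fst, xwOf_wOfX_fst]

/-- **O-reindex, PROVED**: on the e-free words of each degree `p` the dictionary is a bijection onto the diagonal compound words of size `p`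
(so (XF1) `Σ_{|I|=p} (I;I) = h^p∕p!` restricts to (F1) `Σ_{e-free, deg p} w = h^p∕p!`). -/
theorem xwOf_bijOn (p : ℕ) : Set.BijOn xwOf ↑(eFreeWordsOfDeg p) ↑(diagXWords p) := by
  refine ⟨fun w hw => ?_, fun w hw w' hw' h => ?_, fun IJ hIJ => ?_⟩
  · obtain ⟨hd, he⟩ := mem_eFreeWordsOfDeg.1 (Finset.mem_coe.1 hw)
    exact Finset.mem_coe.2 (mem_diagXWords.2
      ⟨⟨(card_xwOf_fst w).trans hd, (card_xwOf_snd w).trans hd⟩, xwOf_fst_eq_snd he⟩)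
  · exact xwOf_injOn_eFree (mem_eFreeWordsOfDeg.1 (Finset.mem_coe.1 hw)).2 (mem_eFreeWordsOfDeg.1 (Finset.mem_coe.1 hw')).2 h
  · obtain ⟨I, J⟩ := IJ
    obtain ⟨⟨hI, -⟩, hdiag⟩ := mem_diagXWords.1 (Finset.mem_coe.1 hIJ)
    dsimp only at hI hdiag
    subst hdiag
    exact ⟨wOfX I, Finset.mem_coe.2 (mem_eFreeWordsOfDeg.2 ⟨(wdeg_wOfX I).trans hI, eFree_wOfX I⟩), xwOf_wOfX I⟩

/-- **THE BOX RESTRICTION OF A COMPOUND FRAME**: read a box word through the dictionary (`cls p w := xcls p (xwOf w)`). -/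
def XWordFrame.toWordFrame (Φ : XWordFrame E₀) : WordFrame E₀ := ⟨fun p w => Φ.xcls p (xwOf w)⟩

theorem XWordFrame.toWordFrame_cls (Φ : XWordFrame E₀) (p : ℕ) (w : CWord) : Φ.toWordFrame.cls p w = Φ.xcls p (xwOf w) := rfl

/-- **A LINKED COMPOUND FRAME RESTRICTS TO A LINKED BOX FRAME** (v4 `WordFrame.LinksTo`): (XF1) ⟹ (F1) along the bijection `xwOf_bijOn`, (XF2) ⟹ (F2)
by `eeee ↦ E`, `ēēēē ↦ Ē` — ONE frame (O-XF) serves both alphabets; O-WF ⟸ O-XF. -/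
theorem XWordFrame.linksTo_toWordFrame {Φ : XWordFrame E₀} {F : WeilFrame E₀ ψ₀} {h : complexBetti (pad4Anchor E₀).X 2}
    (hΦ : Φ.LinksTo F h) : Φ.toWordFrame.LinksTo F h where
  sum_eFree p := by
    rw [← hΦ.sum_diag p]
    -- NB: the `MapsTo` component is converted to finset membership EXPLICITLY (`Finset.mem_coe`): leaving it to definitional unfolding makes the
    -- unifier evaluate `Finset.univ : Finset CWord` (minutes of `whnf`).
    exact Finset.sum_nbij xwOf (fun w hw => Finset.mem_coe.1 ((xwOf_bijOn p).1 (Finset.mem_coe.2 hw))) (xwOf_bijOn p).2.1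
      (xwOf_bijOn p).2.2 fun _ _ => rfl
  rOne_eq := by
    rw [hΦ.rOne_eq, XWordFrame.toWordFrame_cls, XWordFrame.toWordFrame_cls, xwOf_eWord.1, xwOf_eWord.2.1]
  rTwo_eq := by
    rw [hΦ.rTwo_eq, XWordFrame.toWordFrame_cls, XWordFrame.toWordFrame_cls, xwOf_eWord.1, xwOf_eWord.2.1]

end BoxRestriction

/-! ## §26 THE JSON-SIDE DICTIONARY (calibration) THEOREM: compound minors of a box cell's block matrix = its box class tensor

The embedding `NonboxLetter.ofMCell` (`MonadAlphabet` §7.5) puts a balanced box cell `Z` (factor points `(α_f; β_f)`) on the COMPOUND frame as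
the block-diagonal Hermitian matrix `M_Z = ⊕_f [[α_f, β_f], [β̄_f, α_f]]` (`boxMatrix`), whose class function is the compound character
`(I;J) ↦ det M_Z[I;J]` (`compoundCh 1`).  `MonadAlphabet` §7's docstring and the g23∕g24 memos record that the DICTIONARY between the two
readings — «`det M_Z[xwOf w] = ch_Z(w)` for every box word `w`, and `det M_Z[I;J] = 0` off the words `xwOf(CWord)`» — was checked only
numerically (semihom-2 T2-CALIBRATION).  This section PROVES it (`minor_boxMatrix_xwOf`, `minor_boxMatrix_eq_zero_of_not_xBalanced`,
packaged as `compoundCh_boxMatrix : compoundCh 1 (boxMatrix Z) = xT (MCell.ch Z)`), with its consequences for the checker: the transport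
`xT` of box tensors to the compound frame matches the two (A1)-screens (`xScreen_xT_iff : XScreen (xT T) ↔ ClassScreen T`), the Hodge numbers
(`xT T E = T e`, so `μ`, `rank` agree), and the realisation predicates over a compound frame and its restricted box frame
(`classOf_xT : Φ.classOf k (xT T) = Φ.toWordFrame.classOf k T`, `xRealisesTensor_xT_iff`).  So the compound-frame checker of §25 RESTRICTED to
box designs is LITERALLY the box checker of §1–§24 — the compound frame only adds cells, never changes a verdict on a box design.

Proof architecture (no `decide` over the `6⁴` box words or the `2¹⁶` compound words): (a) the increasing enumeration `enum8 (xwOf w).1` is the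
concatenation over the factors `f = 0,1,2,3` of the slot lists of the letters `w f` (`enum8_xwOf_fst∕snd`); (b) PEELING: the determinant of a
square submatrix read along appended row∕column lists is the product of the two diagonal blocks as soon as the lower-left block vanishes
(`det_subLL_append`, `Matrix.det_fromBlocks_zero₂₁` along `Fin |A| ⊕ Fin |B| ≃ Fin |A ++ B|`), and `M_Z` vanishes across factors; (c) the
per-letter `0×0 ∕ 1×1 ∕ 2×2` blocks have determinants `1, α, α, β, β̄, α² − ββ̄ = φ(letter)` (`det_subLL_letter`); (d) off the balanced words a
factor block meets more rows than columns, and a square matrix with `p` rows supported in `< p` columns has determinant `0`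
(`det_eq_zero_of_rows_supported`, permutation expansion + pigeonhole — Frobenius–König in its trivial case). -/

section Calibration

variable {R : Type} [CommRing R]

/-! ### §26.1 Square submatrices read along index lists; peeling; the supported-rows vanishing lemma -/

/-- the square submatrix of `M` read along two index LISTS of equal length (rows `L`, columns `L'`) — exactly how `minor` reads `M[I;J]`
along `enum8 I`, `enum8 J`. -/
def subLL (M : Matrix (Fin 8) (Fin 8) R) (L L' : List (Fin 8)) (h : L'.length = L.length) :
    Matrix (Fin L.length) (Fin L.length) R :=
  M.submatrix (fun i => L.get i) (fun j => L'.get (Fin.cast h.symm j))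

/-- `minor` unfolded along `subLL` (definitional). -/
theorem minor_eq_dite (M : Matrix (Fin 8) (Fin 8) R) (I J : Finset (Fin 8)) :
    minor M I J = if h : (enum8 J).length = (enum8 I).length then (subLL M (enum8 I) (enum8 J) h).det else 0 := rfl

/-- transport of `det (subLL …)` along equalities of the two lists (the length proof is irrelevant). -/
theorem det_subLL_congr {M : Matrix (Fin 8) (Fin 8) R} {L₁ L₂ L₁' L₂' : List (Fin 8)} (hL : L₁ = L₂) (hL' : L₁' = L₂')
    (h₁ : L₁'.length = L₁.length) (h₂ : L₂'.length = L₂.length) : (subLL M L₁ L₁' h₁).det = (subLL M L₂ L₂' h₂).det := by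
  subst hL; subst hL'; rfl

/-- reading `det (subLL …)` through explicit index functions on `Fin n` once the lists are known entry by entry. -/
theorem det_subLL_eq {M : Matrix (Fin 8) (Fin 8) R} {L L' : List (Fin 8)} (h : L'.length = L.length) {n : ℕ} (hn : L.length = n)
    (r c : Fin n → Fin 8) (hr : ∀ i : Fin n, L.get (Fin.cast hn.symm i) = r i)
    (hc : ∀ j : Fin n, L'.get (Fin.cast (h.trans hn).symm j) = c j) : (subLL M L L' h).det = (M.submatrix r c).det := by
  subst hn
  congr 1
  ext i j
  simp only [subLL, Matrix.submatrix_apply]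
  rw [← hr i, ← hc j]
  rfl

/-- positions of an appended list: `Fin |A| ⊕ Fin |B| ≃ Fin |A ++ B|` (left summand first). -/
def appendEquiv (A B : List (Fin 8)) : Fin A.length ⊕ Fin B.length ≃ Fin (A ++ B).length :=
  finSumFinEquiv.trans (finCongr (List.length_append).symm)

theorem appendEquiv_inl_val (A B : List (Fin 8)) (i : Fin A.length) : ((appendEquiv A B (Sum.inl i) : Fin _) : ℕ) = i := by
  simp [appendEquiv]

theorem appendEquiv_inr_val (A B : List (Fin 8)) (i : Fin B.length) : ((appendEquiv A B (Sum.inr i) : Fin _) : ℕ) = A.length + i := by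
  simp [appendEquiv]

/-- entries of an appended list at the positions of `appendEquiv`. -/
theorem get_appendEquiv_inl (A B : List (Fin 8)) (i : Fin A.length) : (A ++ B).get (appendEquiv A B (Sum.inl i)) = A.get i := by
  simp only [List.get_eq_getElem, appendEquiv_inl_val]
  exact List.getElem_append_left i.isLt

theorem get_appendEquiv_inr (A B : List (Fin 8)) (i : Fin B.length) : (A ++ B).get (appendEquiv A B (Sum.inr i)) = B.get i := by
  simp only [List.get_eq_getElem, appendEquiv_inr_val]
  rw [List.getElem_append_right (Nat.le_add_right _ _)]
  simp only [Nat.add_sub_cancel_left]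

/-- **PEELING**: along appended row lists `A ++ B` and column lists `A' ++ B'` (`|A'| = |A|`, `|B'| = |B|`), if `M` vanishes on `B × A'` (the
lower-left block) then `det M[A ++ B; A' ++ B'] = det M[A; A'] · det M[B; B']`. -/
theorem det_subLL_append (M : Matrix (Fin 8) (Fin 8) R) {A B A' B' : List (Fin 8)} (hA : A'.length = A.length)
    (hB : B'.length = B.length) (h : (A' ++ B').length = (A ++ B).length) (hz : ∀ x ∈ B, ∀ y ∈ A', M x y = 0) :
    (subLL M (A ++ B) (A' ++ B') h).det = (subLL M A A' hA).det * (subLL M B B' hB).det := by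
  rw [← Matrix.det_submatrix_equiv_self (appendEquiv A B)]
  have hcol : ∀ j : Fin (A ++ B).length,
      (A' ++ B').get (Fin.cast h.symm j) = (A' ++ B').get (appendEquiv A' B' ((appendEquiv A B).symm j |>.map (Fin.cast hA.symm) (Fin.cast hB.symm))) := by
    intro j
    obtain ⟨x, rfl⟩ := (appendEquiv A B).surjective j
    rcases x with i | i
    · simp only [Equiv.symm_apply_apply, Sum.map_inl, List.get_eq_getElem, Fin.val_cast, appendEquiv_inl_val]
    · simp only [Equiv.symm_apply_apply, Sum.map_inr, List.get_eq_getElem, Fin.val_cast, appendEquiv_inr_val, hA]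
  have key : (subLL M (A ++ B) (A' ++ B') h).submatrix (appendEquiv A B) (appendEquiv A B) =
      Matrix.fromBlocks (subLL M A A' hA) (Matrix.of fun i j => M (A.get i) (B'.get (Fin.cast hB.symm j))) 0 (subLL M B B' hB) := by
    ext x y
    simp only [Matrix.submatrix_apply, subLL, hcol, Equiv.symm_apply_apply]
    rcases x with i | i <;> rcases y with j | j
    · simp only [Sum.map_inl, get_appendEquiv_inl, Matrix.fromBlocks_apply₁₁, Matrix.submatrix_apply]
    · simp only [Sum.map_inr, get_appendEquiv_inl, get_appendEquiv_inr, Matrix.fromBlocks_apply₁₂, Matrix.of_apply]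
    · simp only [Sum.map_inl, get_appendEquiv_inr, get_appendEquiv_inl, Matrix.fromBlocks_apply₂₁, Matrix.zero_apply]
      exact hz _ (List.get_mem _ _) _ (List.get_mem _ _)
    · simp only [Sum.map_inr, get_appendEquiv_inr, Matrix.fromBlocks_apply₂₂, Matrix.submatrix_apply]
  rw [key, Matrix.det_fromBlocks_zero₂₁]

/-- **a square matrix `p` of whose rows are jointly supported in fewer than `p` columns has determinant `0`** (every permutation hits a zero:
pigeonhole on `σ⁻¹(rows) ⊄ columns`; Frobenius–König in its trivial case). -/
theorem det_eq_zero_of_rows_supported {n : Type*} [Fintype n] [DecidableEq n] (S : Matrix n n R) (Rw Cl : Finset n)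
    (hsupp : ∀ i ∈ Rw, ∀ j, j ∉ Cl → S i j = 0) (hcard : Cl.card < Rw.card) : S.det = 0 := by
  rw [Matrix.det_apply']
  refine Finset.sum_eq_zero fun σ _ => ?_
  have hT : Cl.card < (Rw.map (Equiv.toEmbedding σ.symm)).card := by simpa only [Finset.card_map] using hcard
  obtain ⟨j, hjT, hjC⟩ := Finset.exists_mem_notMem_of_card_lt_card hT
  obtain ⟨i, hi, hij⟩ := Finset.mem_map.1 hjT
  have hσj : σ j = i := by rw [← hij]; simp
  exact mul_eq_zero_of_right _ (Finset.prod_eq_zero (Finset.mem_univ j) (by rw [hσj]; exact hsupp i hi j hjC))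

/-! ### §26.2 The block matrix of a box cell along the slots: `M_Z(slot f a, slot f' b) = δ_{f f'} · [[α, β], [β̄, α]]_{ab}` -/

/-- the `2 × 2` block `[[α_f, β_f], [β̄_f, α_f]]` of factor `f` of a balanced box cell. -/
def blkM (Z : MCell) (f : Fin 4) : Matrix (Fin 2) (Fin 2) GaussianInt :=
  !![((Z f).1 : GaussianInt), MonadAlphabet.betaG Z f; star (MonadAlphabet.betaG Z f), ((Z f).1 : GaussianInt)]

theorem slot_val_div_two (f : Fin 4) (b : Fin 2) : (slot f b : ℕ) / 2 = f := by
  have hb := b.isLt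
  show (2 * (f : ℕ) + b) / 2 = f
  omega

theorem slot_val_mod_two (f : Fin 4) (b : Fin 2) : (slot f b : ℕ) % 2 = b := by
  have hb := b.isLt
  show (2 * (f : ℕ) + b) % 2 = b
  omega

/-- the block of a global coordinate: coordinate `i` lives in factor `⌊i∕2⌋`. -/
def blk (i : Fin 8) : Fin 4 := ⟨(i : ℕ) / 2, by omega⟩

@[simp] theorem blk_slot (f : Fin 4) (b : Fin 2) : blk (slot f b) = f := Fin.ext (slot_val_div_two f b)

/-- `M_Z` vanishes across factors. -/
theorem boxMatrix_eq_zero_of_blk_ne (Z : MCell) {i j : Fin 8} (h : blk i ≠ blk j) : MonadAlphabet.boxMatrix Z i j = 0 := by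
  have h' : (i : ℕ) / 2 ≠ (j : ℕ) / 2 := fun e => h (Fin.ext e)
  unfold MonadAlphabet.boxMatrix
  rw [Matrix.of_apply, if_neg h']

/-- **`M_Z` along the slots**: block-diagonal with blocks `blkM Z f`. -/
theorem boxMatrix_slot (Z : MCell) (f f' : Fin 4) (a b : Fin 2) :
    MonadAlphabet.boxMatrix Z (slot f a) (slot f' b) = if f = f' then blkM Z f a b else 0 := by
  by_cases hff : f = f'
  · subst hff
    have hof : Fin.ofNat 4 ((slot f a : ℕ) / 2) = f := by rw [slot_val_div_two]; exact Fin.ext (Nat.mod_eq_of_lt f.isLt)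
    unfold MonadAlphabet.boxMatrix
    rw [Matrix.of_apply, if_pos rfl, if_pos (by rw [slot_val_div_two, slot_val_div_two]), slot_val_mod_two, slot_val_mod_two, hof]
    fin_cases a <;> fin_cases b <;> simp [blkM]
  · rw [if_neg hff]
    exact boxMatrix_eq_zero_of_blk_ne Z (by simpa only [blk_slot] using hff)

/-! ### §26.3 Letters as slot lists; the enumeration of `xwOf w` factor by factor; the per-letter blocks -/

/-- local coordinate `b` of factor `f` lies in the `dz̄`-part of `xwOf w` iff it lies in the `dz̄`-part of the letter `w f`. -/
theorem slot_mem_xwOf_snd {w : CWord} {f : Fin 4} {b : Fin 2} : slot f b ∈ (xwOf w).2 ↔ b ∈ zbarLoc (w f) := by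
  constructor
  · intro h
    obtain ⟨f', -, hf'⟩ := Finset.mem_biUnion.1 h
    obtain ⟨b', hb', he⟩ := Finset.mem_image.1 hf'
    obtain ⟨rfl, rfl⟩ := slot_inj he
    exact hb'
  · intro h
    exact Finset.mem_biUnion.2 ⟨f, Finset.mem_univ _, Finset.mem_image.2 ⟨b, h, rfl⟩⟩

/-- increasing list of the `dz`-part of a letter (`zLoc` as a list). -/
def zList : Fin 6 → List (Fin 2) := ![[], [0], [1], [0], [1], [0, 1]]

/-- increasing list of the `dz̄`-part of a letter (`zbarLoc` as a list). -/
def zbarList : Fin 6 → List (Fin 2) := ![[], [0], [1], [1], [0], [0, 1]]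

theorem zList_eq_filter : ∀ l : Fin 6, zList l = ([0, 1] : List (Fin 2)).filter (· ∈ zLoc l) := by decide

theorem zbarList_eq_filter : ∀ l : Fin 6, zbarList l = ([0, 1] : List (Fin 2)).filter (· ∈ zbarLoc l) := by decide

theorem length_zbarList_eq : ∀ l : Fin 6, (zbarList l).length = (zList l).length := by decide

/-- the slots of factor `f` carrying the `dz`-part of letter `l`, increasing. -/
def lList (l : Fin 6) (f : Fin 4) : List (Fin 8) := (zList l).map (slot f)

/-- the slots of factor `f` carrying the `dz̄`-part of letter `l`, increasing. -/
def lbarList (l : Fin 6) (f : Fin 4) : List (Fin 8) := (zbarList l).map (slot f)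

theorem length_lbarList (l : Fin 6) (f : Fin 4) : (lbarList l f).length = (lList l f).length := by
  simp only [lList, lbarList, List.length_map, length_zbarList_eq]

theorem mem_lList {l : Fin 6} {f : Fin 4} {x : Fin 8} (h : x ∈ lList l f) : ∃ b, x = slot f b := by
  obtain ⟨b, -, rfl⟩ := List.mem_map.1 h; exact ⟨b, rfl⟩

theorem mem_lbarList {l : Fin 6} {f : Fin 4} {x : Fin 8} (h : x ∈ lbarList l f) : ∃ b, x = slot f b := by
  obtain ⟨b, -, rfl⟩ := List.mem_map.1 h; exact ⟨b, rfl⟩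

/-- `M_Z` vanishes between the slot lists of different factors. -/
theorem boxMatrix_zero_of_mem (Z : MCell) {f f' : Fin 4} (hff : f ≠ f') {l l' : Fin 6} {x y : Fin 8} (hx : x ∈ lList l f)
    (hy : y ∈ lbarList l' f') : MonadAlphabet.boxMatrix Z x y = 0 := by
  obtain ⟨a, rfl⟩ := mem_lList hx
  obtain ⟨b, rfl⟩ := mem_lbarList hy
  rw [boxMatrix_slot, if_neg hff]

/-- the eight coordinates in increasing order are the slots, factor by factor. -/
theorem finRange_eight_eq_slots : List.finRange 8 = ([0, 1] : List (Fin 2)).map (slot 0) ++ (([0, 1] : List (Fin 2)).map (slot 1) ++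
    (([0, 1] : List (Fin 2)).map (slot 2) ++ ([0, 1] : List (Fin 2)).map (slot 3))) := by decide

theorem filter_slots_xwOf_fst (w : CWord) (f : Fin 4) :
    (([0, 1] : List (Fin 2)).map (slot f)).filter (· ∈ (xwOf w).1) = lList (w f) f := by
  rw [List.filter_map, lList, zList_eq_filter]
  congr 1
  exact List.filter_congr fun b _ => by simp only [Function.comp_apply, slot_mem_xwOf_fst]

theorem filter_slots_xwOf_snd (w : CWord) (f : Fin 4) :
    (([0, 1] : List (Fin 2)).map (slot f)).filter (· ∈ (xwOf w).2) = lbarList (w f) f := by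
  rw [List.filter_map, lbarList, zbarList_eq_filter]
  congr 1
  exact List.filter_congr fun b _ => by simp only [Function.comp_apply, slot_mem_xwOf_snd]

/-- **(a) the increasing enumeration of the `dz`-part of `xwOf w` is the concatenation of the per-factor slot lists of its letters.** -/
theorem enum8_xwOf_fst (w : CWord) :
    enum8 (xwOf w).1 = lList (w 0) 0 ++ (lList (w 1) 1 ++ (lList (w 2) 2 ++ lList (w 3) 3)) := by
  unfold MonadAlphabet.enum8
  rw [finRange_eight_eq_slots]
  simp only [List.filter_append, filter_slots_xwOf_fst]

theorem enum8_xwOf_snd (w : CWord) :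
    enum8 (xwOf w).2 = lbarList (w 0) 0 ++ (lbarList (w 1) 1 ++ (lbarList (w 2) 2 ++ lbarList (w 3) 3)) := by
  unfold MonadAlphabet.enum8
  rw [finRange_eight_eq_slots]
  simp only [List.filter_append, filter_slots_xwOf_snd]

/-- `α² − β β̄` of a factor point is its top class `p = a² − b² − c²`. -/
theorem alpha_sq_sub_beta_mul_star (x : BPoint) :
    (x.1 : GaussianInt) * (x.1 : GaussianInt) - (⟨x.2.1, x.2.2⟩ : GaussianInt) * star (⟨x.2.1, x.2.2⟩ : GaussianInt) =
      ((x.1 ^ 2 - x.2.1 ^ 2 - x.2.2 ^ 2 : ℤ) : GaussianInt) := by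
  rw [Zsqrtd.star_mk]
  ext
  · simp only [Zsqrtd.re_sub, Zsqrtd.re_mul, Zsqrtd.re_intCast, Zsqrtd.im_intCast]
    ring
  · simp only [Zsqrtd.im_sub, Zsqrtd.im_mul, Zsqrtd.re_intCast, Zsqrtd.im_intCast]
    ring

/-- **(c) the per-letter blocks**: `det M_Z[lList l f; lbarList l f] = φ_{Z f}(l)` — `1, α, α, β, β̄, α² − ββ̄` for `l = 1, z, z̄, e, ē, p`. -/
theorem det_subLL_letter (Z : MCell) (f : Fin 4) (l : Fin 6) :
    (subLL (MonadAlphabet.boxMatrix Z) (lList l f) (lbarList l f) (length_lbarList l f)).det = bphi (Z f) l := by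
  fin_cases l
  · rw [det_subLL_eq _ (n := 0) rfl Fin.elim0 Fin.elim0 (fun i => i.elim0) (fun j => j.elim0), Matrix.det_fin_zero]
    simp [bphi, phiVec]
  · rw [det_subLL_eq _ (n := 1) rfl ![slot f 0] ![slot f 0] (fun i => by fin_cases i; rfl) (fun j => by fin_cases j; rfl),
      Matrix.det_fin_one]
    simp [boxMatrix_slot, blkM, bphi, phiVec]
  · rw [det_subLL_eq _ (n := 1) rfl ![slot f 1] ![slot f 1] (fun i => by fin_cases i; rfl) (fun j => by fin_cases j; rfl),
      Matrix.det_fin_one]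
    simp [boxMatrix_slot, blkM, bphi, phiVec]
  · rw [det_subLL_eq _ (n := 1) rfl ![slot f 0] ![slot f 1] (fun i => by fin_cases i; rfl) (fun j => by fin_cases j; rfl),
      Matrix.det_fin_one]
    simp [boxMatrix_slot, blkM, bphi, phiVec, MonadAlphabet.betaG]
  · rw [det_subLL_eq _ (n := 1) rfl ![slot f 1] ![slot f 0] (fun i => by fin_cases i; rfl) (fun j => by fin_cases j; rfl),
      Matrix.det_fin_one]
    simp [boxMatrix_slot, blkM, bphi, phiVec, MonadAlphabet.betaG, Zsqrtd.star_mk]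
  · rw [det_subLL_eq _ (n := 2) rfl ![slot f 0, slot f 1] ![slot f 0, slot f 1] (fun i => by fin_cases i <;> rfl)
      (fun j => by fin_cases j <;> rfl), Matrix.det_fin_two]
    simp only [Matrix.submatrix_apply, Matrix.cons_val_zero, Matrix.cons_val_one, boxMatrix_slot, if_true, blkM,
      Matrix.of_apply, Matrix.cons_val', Matrix.empty_val', Matrix.cons_val_fin_one, MonadAlphabet.betaG]
    rw [alpha_sq_sub_beta_mul_star]
    simp [bphi, phiVec]

/-! ### §26.4 THE DICTIONARY THEOREM (D1): `det M_Z[xwOf w] = ch_Z(w)` -/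

/-- **THE DICTIONARY THEOREM (D1).** For every balanced box cell `Z` and every box word `w`, the compound minor of its block matrix at the
compound word `xwOf w` is its box class tensor at `w`: `det M_Z[xwOf w] = ∏_f φ_{Z f}(w f) = ch_Z(w)`. -/
theorem minor_boxMatrix_xwOf (Z : MCell) (w : CWord) : minor (MonadAlphabet.boxMatrix Z) (xwOf w).1 (xwOf w).2 = MCell.ch Z w := by
  have hA := enum8_xwOf_fst w
  have hB := enum8_xwOf_snd w
  have hl : ∀ f, (lbarList (w f) f).length = (lList (w f) f).length := fun f => length_lbarList _ _
  have h3 : (lbarList (w 2) 2 ++ lbarList (w 3) 3).length = (lList (w 2) 2 ++ lList (w 3) 3).length := by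
    simp only [List.length_append, hl]
  have h2 : (lbarList (w 1) 1 ++ (lbarList (w 2) 2 ++ lbarList (w 3) 3)).length =
      (lList (w 1) 1 ++ (lList (w 2) 2 ++ lList (w 3) 3)).length := by simp only [List.length_append, hl]
  have h1 : (lbarList (w 0) 0 ++ (lbarList (w 1) 1 ++ (lbarList (w 2) 2 ++ lbarList (w 3) 3))).length =
      (lList (w 0) 0 ++ (lList (w 1) 1 ++ (lList (w 2) 2 ++ lList (w 3) 3))).length := by simp only [List.length_append, hl]
  have hlen : (enum8 (xwOf w).2).length = (enum8 (xwOf w).1).length := by rw [hA, hB]; exact h1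
  rw [minor_eq_dite, dif_pos hlen, det_subLL_congr hA hB hlen h1, det_subLL_append _ (hl 0) h2, det_subLL_append _ (hl 1) h3,
    det_subLL_append _ (hl 2) (hl 3), det_subLL_letter, det_subLL_letter, det_subLL_letter, det_subLL_letter,
    MonadAlphabet.ch_eq_prod, Fin.prod_univ_four]
  · ring
  · intro x hx y hy
    exact boxMatrix_zero_of_mem Z (by decide) hx hy
  · intro x hx y hy
    rcases List.mem_append.1 hx with hx | hx
    · exact boxMatrix_zero_of_mem Z (by decide) hx hy
    · exact boxMatrix_zero_of_mem Z (by decide) hx hy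
  · intro x hx y hy
    rcases List.mem_append.1 hx with hx | hx
    · exact boxMatrix_zero_of_mem Z (by decide) hx hy
    · rcases List.mem_append.1 hx with hx | hx
      · exact boxMatrix_zero_of_mem Z (by decide) hx hy
      · exact boxMatrix_zero_of_mem Z (by decide) hx hy

/-! ### §26.5 Block-balanced compound words = the image of the dictionary; (D2) the minors of `M_Z` vanish off them -/

/-- **BLOCK-BALANCED** compound word: in every factor block `{2f, 2f+1}` the `dz`-part and the `dz̄`-part have equally many coordinates
(decidable).  These are exactly the words `xwOf w` of box words (`xBalanced_iff_exists`). -/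
abbrev XBalanced (IJ : XWord) : Prop := ∀ f : Fin 4, (IJ.1.filter fun i => blk i = f).card = (IJ.2.filter fun i => blk i = f).card

/-- the local `dz`-part of a compound word in factor `f`. -/
def locFst (IJ : XWord) (f : Fin 4) : Finset (Fin 2) := Finset.univ.filter fun b => slot f b ∈ IJ.1

/-- the local `dz̄`-part of a compound word in factor `f`. -/
def locSnd (IJ : XWord) (f : Fin 4) : Finset (Fin 2) := Finset.univ.filter fun b => slot f b ∈ IJ.2

theorem filter_blk_fst_eq_image (IJ : XWord) (f : Fin 4) : (IJ.1.filter fun i => blk i = f) = (locFst IJ f).image (slot f) := by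
  ext i
  obtain ⟨f', b, rfl⟩ := exists_slot_eq i
  simp only [Finset.mem_filter, blk_slot, Finset.mem_image, locFst, Finset.mem_univ, true_and]
  constructor
  · rintro ⟨h, rfl⟩; exact ⟨b, h, rfl⟩
  · rintro ⟨b', h, he⟩
    obtain ⟨rfl, rfl⟩ := slot_inj he
    exact ⟨h, rfl⟩

theorem filter_blk_snd_eq_image (IJ : XWord) (f : Fin 4) : (IJ.2.filter fun i => blk i = f) = (locSnd IJ f).image (slot f) := by
  ext i
  obtain ⟨f', b, rfl⟩ := exists_slot_eq i
  simp only [Finset.mem_filter, blk_slot, Finset.mem_image, locSnd, Finset.mem_univ, true_and]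
  constructor
  · rintro ⟨h, rfl⟩; exact ⟨b, h, rfl⟩
  · rintro ⟨b', h, he⟩
    obtain ⟨rfl, rfl⟩ := slot_inj he
    exact ⟨h, rfl⟩

/-- balanced ⟺ the local parts have equal sizes factor by factor. -/
theorem xBalanced_iff_loc (IJ : XWord) : XBalanced IJ ↔ ∀ f, (locFst IJ f).card = (locSnd IJ f).card := by
  refine forall_congr' fun f => ?_
  rw [filter_blk_fst_eq_image, filter_blk_snd_eq_image, Finset.card_image_of_injective _ (slot_injective f),
    Finset.card_image_of_injective _ (slot_injective f)]

theorem locFst_xwOf (w : CWord) (f : Fin 4) : locFst (xwOf w) f = zLoc (w f) := by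
  ext b; simp only [locFst, Finset.mem_filter, Finset.mem_univ, true_and, slot_mem_xwOf_fst]

theorem locSnd_xwOf (w : CWord) (f : Fin 4) : locSnd (xwOf w) f = zbarLoc (w f) := by
  ext b; simp only [locSnd, Finset.mem_filter, Finset.mem_univ, true_and, slot_mem_xwOf_snd]

/-- the words of the dictionary are balanced. -/
theorem xBalanced_xwOf (w : CWord) : XBalanced (xwOf w) :=
  (xBalanced_iff_loc _).2 fun f => by rw [locFst_xwOf, locSnd_xwOf, (card_zLoc _).1, (card_zLoc _).2]

/-- THE LETTER READER: the letter whose (`dz`, `dz̄`)-parts are `(P, Q)` (meaningful when `|P| = |Q|`). -/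
def readLetter (P Q : Finset (Fin 2)) : Fin 6 :=
  if 0 ∈ P then (if 1 ∈ P then 5 else (if 0 ∈ Q then 1 else 3)) else (if 1 ∈ P then (if 1 ∈ Q then 2 else 4) else 0)

/-- letter table: every pair of local parts of equal size IS a letter. [`decide`] -/
theorem zLoc_readLetter : ∀ P Q : Finset (Fin 2), P.card = Q.card → zLoc (readLetter P Q) = P ∧ zbarLoc (readLetter P Q) = Q := by
  decide

/-- letter table: reading the parts of a letter returns the letter. [`decide`] -/
theorem readLetter_zLoc : ∀ l : Fin 6, readLetter (zLoc l) (zbarLoc l) = l := by decide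

/-- THE WORD READER: the box word read off a compound word, factor by factor (a right inverse of `xwOf` on the balanced words, a left
inverse everywhere). -/
def wordOfX (IJ : XWord) : CWord := fun f => readLetter (locFst IJ f) (locSnd IJ f)

theorem wordOfX_xwOf (w : CWord) : wordOfX (xwOf w) = w := by
  funext f; simp only [wordOfX, locFst_xwOf, locSnd_xwOf, readLetter_zLoc]

/-- **the dictionary is injective** (on all box words, not only the e-free ones). -/
theorem xwOf_injective : Function.Injective xwOf := Function.LeftInverse.injective wordOfX_xwOf

theorem xwOf_wordOfX {IJ : XWord} (h : XBalanced IJ) : xwOf (wordOfX IJ) = IJ := by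
  have hl := (xBalanced_iff_loc IJ).1 h
  refine Prod.ext (Finset.ext fun i => ?_) (Finset.ext fun i => ?_)
  · obtain ⟨f, b, rfl⟩ := exists_slot_eq i
    rw [slot_mem_xwOf_fst, wordOfX, (zLoc_readLetter _ _ (hl f)).1, locFst]
    simp only [Finset.mem_filter, Finset.mem_univ, true_and]
  · obtain ⟨f, b, rfl⟩ := exists_slot_eq i
    rw [slot_mem_xwOf_snd, wordOfX, (zLoc_readLetter _ _ (hl f)).2, locSnd]
    simp only [Finset.mem_filter, Finset.mem_univ, true_and]

/-- **balanced = in the image of the dictionary.** -/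
theorem xBalanced_iff_exists (IJ : XWord) : XBalanced IJ ↔ ∃ w, xwOf w = IJ :=
  ⟨fun h => ⟨wordOfX IJ, xwOf_wordOfX h⟩, fun ⟨w, hw⟩ => hw ▸ xBalanced_xwOf w⟩

/-- `enum8 I` lists `I` without repetition … -/
theorem nodup_enum8 (I : Finset (Fin 8)) : (enum8 I).Nodup := (List.nodup_finRange 8).filter _

theorem mem_enum8 {I : Finset (Fin 8)} {x : Fin 8} : x ∈ enum8 I ↔ x ∈ I := by
  unfold MonadAlphabet.enum8
  simp only [List.mem_filter, List.mem_finRange, true_and, decide_eq_true_eq]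

/-- … hence has `|I|` entries. -/
theorem length_enum8 (I : Finset (Fin 8)) : (enum8 I).length = I.card := by
  rw [← List.toFinset_card_of_nodup (nodup_enum8 I)]
  congr 1
  ext x
  rw [List.mem_toFinset, mem_enum8]

/-- an unbalanced pair of coordinate sets of equal size has a factor block with MORE `dz`- than `dz̄`-coordinates. -/
theorem exists_blk_lt_of_not_xBalanced {IJ : XWord} (h : ¬ XBalanced IJ) (hc : IJ.1.card = IJ.2.card) :
    ∃ f : Fin 4, (IJ.2.filter fun i => blk i = f).card < (IJ.1.filter fun i => blk i = f).card := by
  by_contra hno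
  push Not at hno
  obtain ⟨f₀, hf₀⟩ := not_forall.1 h
  have hlt : (IJ.1.filter fun i => blk i = f₀).card < (IJ.2.filter fun i => blk i = f₀).card := lt_of_le_of_ne (hno f₀) hf₀
  have h1 : IJ.1.card = ∑ f : Fin 4, (IJ.1.filter fun i => blk i = f).card :=
    Finset.card_eq_sum_card_fiberwise fun x _ => Finset.mem_coe.2 (Finset.mem_univ (blk x))
  have h2 : IJ.2.card = ∑ f : Fin 4, (IJ.2.filter fun i => blk i = f).card :=
    Finset.card_eq_sum_card_fiberwise fun x _ => Finset.mem_coe.2 (Finset.mem_univ (blk x))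
  have hsum : ∑ f : Fin 4, (IJ.1.filter fun i => blk i = f).card < ∑ f : Fin 4, (IJ.2.filter fun i => blk i = f).card :=
    Finset.sum_lt_sum (fun f _ => hno f) ⟨f₀, Finset.mem_univ _, hlt⟩
  omega

/-- **(D2) THE MINORS OF `M_Z` VANISH OFF THE BALANCED WORDS** (in an unbalanced word of square shape some factor block has `p` rows of the
submatrix supported in its `< p` columns). -/
theorem minor_boxMatrix_eq_zero_of_not_xBalanced (Z : MCell) {IJ : XWord} (h : ¬ XBalanced IJ) :
    minor (MonadAlphabet.boxMatrix Z) IJ.1 IJ.2 = 0 := by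
  rw [minor_eq_dite]
  split_ifs with hlen
  swap
  · rfl
  have hc : IJ.1.card = IJ.2.card := by rw [← length_enum8, ← length_enum8, hlen]
  obtain ⟨f, hf⟩ := exists_blk_lt_of_not_xBalanced h hc
  -- rows ∕ columns of the submatrix lying in block `f`
  let row : Fin (enum8 IJ.1).length → Fin 8 := fun t => (enum8 IJ.1).get t
  let col : Fin (enum8 IJ.1).length → Fin 8 := fun t => (enum8 IJ.2).get (Fin.cast hlen.symm t)
  have hrow : Function.Injective row := List.nodup_iff_injective_get.1 (nodup_enum8 _)
  have hcol : Function.Injective col := fun t t' e =>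
    Fin.cast_injective _ (List.nodup_iff_injective_get.1 (nodup_enum8 _) e)
  refine det_eq_zero_of_rows_supported _ (Finset.univ.filter fun t => blk (row t) = f) (Finset.univ.filter fun t => blk (col t) = f)
    (fun t ht t' ht' => boxMatrix_eq_zero_of_blk_ne Z ?_) ?_
  · simp only [Finset.mem_filter, Finset.mem_univ, true_and] at ht ht'
    rw [ht]; exact Ne.symm ht'
  · -- the two filters are copies of the block-`f` parts of `IJ.2`, `IJ.1`
    have e1 : (Finset.univ.filter fun t => blk (row t) = f).card = (IJ.1.filter fun i => blk i = f).card := by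
      rw [← Finset.card_image_of_injective _ hrow]
      congr 1
      ext x
      simp only [Finset.mem_image, Finset.mem_filter, Finset.mem_univ, true_and]
      constructor
      · rintro ⟨t, ht, rfl⟩; exact ⟨mem_enum8.1 (List.get_mem _ _), ht⟩
      · rintro ⟨hx, hb⟩
        obtain ⟨t, ht⟩ := List.mem_iff_get.1 (mem_enum8.2 hx)
        exact ⟨t, by rw [show row t = x from ht]; exact hb, ht⟩
    have e2 : (Finset.univ.filter fun t => blk (col t) = f).card = (IJ.2.filter fun i => blk i = f).card := by
      rw [← Finset.card_image_of_injective _ hcol]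
      congr 1
      ext x
      simp only [Finset.mem_image, Finset.mem_filter, Finset.mem_univ, true_and]
      constructor
      · rintro ⟨t, ht, rfl⟩; exact ⟨mem_enum8.1 (List.get_mem _ _), ht⟩
      · rintro ⟨hx, hb⟩
        obtain ⟨t, ht⟩ := List.mem_iff_get.1 (mem_enum8.2 hx)
        refine ⟨Fin.cast hlen t, ?_, ?_⟩
        · show blk ((enum8 IJ.2).get (Fin.cast hlen.symm (Fin.cast hlen t))) = f
          rw [show Fin.cast hlen.symm (Fin.cast hlen t) = t from Fin.ext rfl, ht]; exact hb
        · show (enum8 IJ.2).get (Fin.cast hlen.symm (Fin.cast hlen t)) = x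
          rw [show Fin.cast hlen.symm (Fin.cast hlen t) = t from Fin.ext rfl, ht]
    rw [e1, e2]; exact hf

/-- (D2) in range form. -/
theorem minor_boxMatrix_eq_zero_of_forall_ne (Z : MCell) {IJ : XWord} (h : ∀ w, xwOf w ≠ IJ) :
    minor (MonadAlphabet.boxMatrix Z) IJ.1 IJ.2 = 0 :=
  minor_boxMatrix_eq_zero_of_not_xBalanced Z fun hb => by obtain ⟨w, hw⟩ := (xBalanced_iff_exists IJ).1 hb; exact h w hw

/-! ### §26.6 THE TRANSPORT `xT` of box tensors to the compound frame; `compoundCh 1 (boxMatrix Z) = xT (ch Z)` -/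

/-- **THE TRANSPORT** of a box class tensor to the compound frame: a balanced word carries the value at the box word it reads, every other
word carries `0`. -/
def xT (T : CWord → R) : XWord → R := fun IJ => if XBalanced IJ then T (wordOfX IJ) else 0

@[simp] theorem xT_xwOf (T : CWord → R) (w : CWord) : xT T (xwOf w) = T w := by
  simp only [xT, if_pos (xBalanced_xwOf w), wordOfX_xwOf]

theorem xT_of_not_xBalanced (T : CWord → R) {IJ : XWord} (h : ¬ XBalanced IJ) : xT T IJ = 0 := if_neg h

@[simp] theorem xT_zero : xT (0 : CWord → R) = 0 := by
  funext IJ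
  by_cases h : XBalanced IJ
  · simp only [xT, if_pos h, Pi.zero_apply]
  · simp only [xT, if_neg h, Pi.zero_apply]

theorem xT_add (T T' : CWord → R) : xT (T + T') = xT T + xT T' := by
  funext IJ
  by_cases h : XBalanced IJ
  · simp only [xT, if_pos h, Pi.add_apply]
  · simp only [xT, if_neg h, Pi.add_apply, add_zero]

theorem xT_sub (T T' : CWord → R) : xT (T - T') = xT T - xT T' := by
  funext IJ
  by_cases h : XBalanced IJ
  · simp only [xT, if_pos h, Pi.sub_apply]
  · simp only [xT, if_neg h, Pi.sub_apply, sub_zero]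

theorem xT_neg (T : CWord → R) : xT (-T) = -xT T := by
  funext IJ
  by_cases h : XBalanced IJ
  · simp only [xT, if_pos h, Pi.neg_apply]
  · simp only [xT, if_neg h, Pi.neg_apply, neg_zero]

theorem xT_zsmul (n : ℤ) (T : CWord → R) : xT (n • T) = n • xT T := by
  funext IJ
  by_cases h : XBalanced IJ
  · simp only [xT, if_pos h, Pi.smul_apply]
  · simp only [xT, if_neg h, Pi.smul_apply, smul_zero]

theorem xT_sum {ι : Type*} (s : Finset ι) (T : ι → CWord → R) : xT (∑ i ∈ s, T i) = ∑ i ∈ s, xT (T i) := by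
  classical
  induction s using Finset.induction_on with
  | empty => simp
  | insert a s ha ih => rw [Finset.sum_insert ha, Finset.sum_insert ha, xT_add, ih]

theorem xT_injective : Function.Injective (xT : (CWord → R) → XWord → R) := fun T T' h => by
  funext w; rw [← xT_xwOf T w, ← xT_xwOf T' w, h]

/-- the distinguished words correspond: `E = xwOf eeee`, `Ē = xwOf ēēēē`, `(∅;∅) = xwOf 1111`. -/
theorem xT_eXWord (T : CWord → R) : xT T eXWord = T eWord := by rw [← xwOf_eWord.1, xT_xwOf]

theorem xT_ebarXWord (T : CWord → R) : xT T ebarXWord = T ebarWord := by rw [← xwOf_eWord.2.1, xT_xwOf]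

theorem xT_oneXWord (T : CWord → R) : xT T oneXWord = T MonadAlphabet.oneWord := by rw [← xwOf_eWord.2.2.1, xT_xwOf]; rfl

/-- **THE DICTIONARY THEOREM, packaged**: the compound class function of the block matrix of a box cell IS the transport of its box class
tensor — (D1) on the balanced words, (D2) off them. -/
theorem compoundCh_boxMatrix (Z : MCell) : compoundCh 1 (MonadAlphabet.boxMatrix Z) = xT (MCell.ch Z) := by
  funext IJ
  show (((1 : ℕ) : GaussianInt)) * minor (MonadAlphabet.boxMatrix Z) IJ.1 IJ.2 = xT (MCell.ch Z) IJ
  rw [Nat.cast_one, one_mul]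
  by_cases h : XBalanced IJ
  · rw [← xwOf_wordOfX h, minor_boxMatrix_xwOf, xT_xwOf]
  · rw [minor_boxMatrix_eq_zero_of_not_xBalanced Z h, xT_of_not_xBalanced _ h]

/-- … in the alphabet's words: the compound cell `ofMCell Z` has class function `xT (ch Z)`. -/
theorem nonboxAlphabet_ch_ofMCell (Z : MCell) : nonboxAlphabet.ch (NonboxLetter.ofMCell Z) = xT (MonadAlphabet.bAlph.ch Z) :=
  compoundCh_boxMatrix Z

/-- the same in `simp`-normal form (`nonboxAlphabet.ch` unfolded). -/
theorem compoundCh_ofMCell (Z : MCell) : compoundCh ((NonboxLetter.ofMCell Z).rk : ℕ) (NonboxLetter.ofMCell Z).M = xT (MCell.ch Z) :=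
  compoundCh_boxMatrix Z

/-! ### §26.7 CALIBRATION OF THE SCREENS AND THE HODGE NUMBERS: `XScreen (xT T) ↔ ClassScreen T`, `xT T E = T e` -/

/-- an e-free reading: the word read off a DIAGONAL compound word is e-free. -/
theorem eFree_wordOfX_diag (I : Finset (Fin 8)) : EFree (wordOfX (I, I)) := fun f => by
  have key : ∀ P : Finset (Fin 2), readLetter P P ≠ 3 ∧ readLetter P P ≠ 4 := by decide
  exact key _

theorem xBalanced_diag (I : Finset (Fin 8)) : XBalanced (I, I) := fun _ => rfl

/-- a word that is NOT e-free goes to an OFF-diagonal compound word. -/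
theorem xwOf_fst_ne_snd {w : CWord} (hw : ¬ EFree w) : (xwOf w).1 ≠ (xwOf w).2 := by
  intro h
  apply hw
  intro f
  have hloc : zLoc (w f) = zbarLoc (w f) := by rw [← locFst_xwOf w f, ← locSnd_xwOf w f, locFst, locSnd, h]
  have key : ∀ l : Fin 6, zLoc l = zbarLoc l → l ≠ 3 ∧ l ≠ 4 := by decide
  exact key _ hloc

/-- **SCREEN CALIBRATION**: the compound (A1)-screen of the transported tensor is the box (A1)-screen of the tensor. -/
theorem xScreen_xT_iff (T : CWord → R) : XScreen (xT T) ↔ ClassScreen T := by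
  constructor
  · rintro ⟨hoff, hdiag⟩
    refine ⟨fun w hw hwe hwe' => ?_, fun w w' hw hw' hd => ?_⟩
    · rw [← xT_xwOf T w]
      refine hoff _ _ (xwOf_fst_ne_snd hw) (fun h => hwe (xwOf_injective ?_)) (fun h => hwe' (xwOf_injective ?_))
      · rw [xwOf_eWord.1]; exact h
      · rw [xwOf_eWord.2.1]; exact h
    · rw [← xT_xwOf T w, ← xT_xwOf T w']
      have h1 : xwOf w = ((xwOf w).1, (xwOf w).1) := Prod.ext rfl (xwOf_fst_eq_snd hw).symm
      have h2 : xwOf w' = ((xwOf w').1, (xwOf w').1) := Prod.ext rfl (xwOf_fst_eq_snd hw').symm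
      rw [h1, h2]
      exact hdiag _ _ (by rw [card_xwOf_fst, card_xwOf_fst, hd])
  · rintro ⟨hoff, hdeg⟩
    refine ⟨fun I J hIJ hE hEbar => ?_, fun I I' hc => ?_⟩
    · by_cases hb : XBalanced (I, J)
      · have hx := xwOf_wordOfX hb
        rw [← hx, xT_xwOf]
        refine hoff _ (fun he => hIJ ?_) (fun he => hE ?_) (fun he => hEbar ?_)
        · have := xwOf_fst_eq_snd he; rw [hx] at this; exact this
        · rw [← hx, he, xwOf_eWord.1]; rfl
        · rw [← hx, he, xwOf_eWord.2.1]; rfl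
      · exact xT_of_not_xBalanced T hb
    · rw [← xwOf_wordOfX (xBalanced_diag I), ← xwOf_wordOfX (xBalanced_diag I'), xT_xwOf, xT_xwOf]
      refine hdeg _ _ (eFree_wordOfX_diag I) (eFree_wordOfX_diag I') ?_
      rw [← card_xwOf_fst, ← card_xwOf_fst, xwOf_wordOfX (xBalanced_diag I), xwOf_wordOfX (xBalanced_diag I')]
      exact hc

/-- the transported class tensor of a box cell is X-tame (its block matrix is Hermitian — proved below — or directly: it is a transport). -/
theorem isHerm_ofMCell (Z : MCell) : (NonboxLetter.ofMCell Z).IsHerm := by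
  show (MonadAlphabet.boxMatrix Z).conjTranspose = MonadAlphabet.boxMatrix Z
  refine Matrix.ext fun i j => ?_
  obtain ⟨f, a, rfl⟩ := exists_slot_eq i
  obtain ⟨f', b, rfl⟩ := exists_slot_eq j
  rw [Matrix.conjTranspose_apply, boxMatrix_slot, boxMatrix_slot]
  by_cases hff : f = f'
  · subst hff
    rw [if_pos rfl, if_pos rfl]
    fin_cases a <;> fin_cases b <;> simp [blkM, Zsqrtd.intCast_val, Zsqrtd.star_mk]
  · rw [if_neg hff, if_neg (Ne.symm hff), star_zero]

/-- the transported class tensor of a box cell is X-tame (its block matrix is Hermitian). -/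
theorem xTame_xT_ch (Z : MCell) : XTame (xT (MCell.ch Z)) := by
  rw [← compoundCh_boxMatrix]; exact xTame_compoundCh_of_isHerm (isHerm_ofMCell Z) _

/-! ### §26.8 BOX DESIGNS RE-READ ON THE COMPOUND FRAME: `toNonbox`, `wch (toNonbox D) = xT (wch D)`; (H1), `μ`, `μ̄`, rank AGREE -/

/-- the block matrix determines the cell (`α_f = M(2f, 2f)`, `β_f = M(2f, 2f+1)`). -/
theorem boxMatrix_injective : Function.Injective MonadAlphabet.boxMatrix := fun Z Z' h => by
  funext f
  have hα := congrFun (congrFun h (slot f 0)) (slot f 0)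
  have hβ := congrFun (congrFun h (slot f 0)) (slot f 1)
  rw [boxMatrix_slot, boxMatrix_slot, if_pos rfl, if_pos rfl] at hα hβ
  simp only [blkM, Matrix.of_apply, Matrix.cons_val', Matrix.cons_val_zero, Matrix.cons_val_one, Matrix.empty_val',
    Matrix.cons_val_fin_one, MonadAlphabet.betaG] at hα hβ
  have h1 : (Z f).1 = (Z' f).1 := by exact_mod_cast hα
  exact Prod.ext h1 (Prod.ext (congrArg Zsqrtd.re hβ) (congrArg Zsqrtd.im hβ))

theorem ofMCell_injective : Function.Injective NonboxLetter.ofMCell := fun _ _ h => boxMatrix_injective (congrArg NonboxLetter.M h)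

/-- box cells ↪ non-box letters. -/
def ofMCellEmb : MCell ↪ NonboxLetter := ⟨NonboxLetter.ofMCell, ofMCell_injective⟩

theorem extend_ofMCell (m : MCell → ℤ) (Z : MCell) : Function.extend NonboxLetter.ofMCell m 0 (NonboxLetter.ofMCell Z) = m Z :=
  ofMCell_injective.extend_apply m 0 Z

/-- **A BOX MONAD DESIGN RE-READ ON THE COMPOUND FRAME**: every cell replaced by its block matrix (rank weight `1`), multiplicities carried along
(extended by `0` off the image of `ofMCell`). -/
def toNonbox (D : MonadAlphabet.MonadDesign MonadAlphabet.bAlph) : MonadAlphabet.MonadDesign nonboxAlphabet :=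
  ⟨D.A.map ofMCellEmb, D.N.map ofMCellEmb, D.C.map ofMCellEmb, Function.extend NonboxLetter.ofMCell D.mA 0,
    Function.extend NonboxLetter.ofMCell D.mN 0, Function.extend NonboxLetter.ofMCell D.mC 0⟩

/-- … and a box two-term presentation. -/
def presToNonbox (Pr : MonadAlphabet.Presentation MonadAlphabet.bAlph) : MonadAlphabet.Presentation nonboxAlphabet :=
  ⟨Pr.N.map ofMCellEmb, Pr.P.map ofMCellEmb, Function.extend NonboxLetter.ofMCell Pr.mN 0, Function.extend NonboxLetter.ofMCell Pr.mP 0⟩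

/-- **THE CLASS TENSOR OF THE RE-READ DESIGN IS THE TRANSPORT OF THE BOX CLASS TENSOR** (the dictionary theorem, summed). -/
theorem wch_toNonbox (D : MonadAlphabet.MonadDesign MonadAlphabet.bAlph) : (toNonbox D).wch = xT D.wch := by
  simp only [MonadAlphabet.MonadDesign.wch, toNonbox, Finset.sum_map, xT_sub, xT_sum, xT_zsmul]
  simp only [ofMCellEmb, Function.Embedding.coeFn_mk, extend_ofMCell, compoundCh_ofMCell, MonadAlphabet.cellCh_bLetters]

theorem wch_presToNonbox (Pr : MonadAlphabet.Presentation MonadAlphabet.bAlph) : (presToNonbox Pr).wch = xT Pr.wch := by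
  simp only [MonadAlphabet.Presentation.wch, presToNonbox, Finset.sum_map, xT_sub, xT_sum, xT_zsmul]
  simp only [ofMCellEmb, Function.Embedding.coeFn_mk, extend_ofMCell, compoundCh_ofMCell, MonadAlphabet.cellCh_bLetters]

/-- the re-read design has Hermitian cells. -/
theorem allHermMonad_toNonbox (D : MonadAlphabet.MonadDesign MonadAlphabet.bAlph) : AllHermMonad (toNonbox D) := by
  refine ⟨fun X hX => ?_, fun X hX => ?_, fun X hX => ?_⟩ <;>
  · obtain ⟨Z, -, rfl⟩ := Finset.mem_map.1 hX
    exact isHerm_ofMCell Z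

theorem allHermPres_presToNonbox (Pr : MonadAlphabet.Presentation MonadAlphabet.bAlph) : AllHermPres (presToNonbox Pr) := by
  refine ⟨fun X hX => ?_, fun X hX => ?_⟩ <;>
  · obtain ⟨Z, -, rfl⟩ := Finset.mem_map.1 hX
    exact isHerm_ofMCell Z

/-- **(H1) AGREES**: the compound screen of the re-read design is the box screen of the design. -/
theorem cleanX_toNonbox_iff (D : MonadAlphabet.MonadDesign MonadAlphabet.bAlph) : (toNonbox D).CleanX ↔ D.Clean := by
  rw [MonadAlphabet.MonadDesign.CleanX, wch_toNonbox, xScreen_xT_iff]; rfl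

/-- **`μ` AGREES**: the Weil minor of the re-read design is the Weil charge of the design. -/
theorem muX_toNonbox (D : MonadAlphabet.MonadDesign MonadAlphabet.bAlph) : (toNonbox D).muX = D.mu := by
  rw [MonadAlphabet.MonadDesign.muX, wch_toNonbox, xT_eXWord]; rfl

theorem muBarX_toNonbox (D : MonadAlphabet.MonadDesign MonadAlphabet.bAlph) : (toNonbox D).muBarX = D.muBar := by
  rw [MonadAlphabet.MonadDesign.muBarX, wch_toNonbox, xT_ebarXWord]; rfl

/-- **rank AGREES.** -/
theorem rankX_toNonbox (D : MonadAlphabet.MonadDesign MonadAlphabet.bAlph) : (toNonbox D).rankX = D.rank := by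
  rw [MonadAlphabet.MonadDesign.rankX, wch_toNonbox, xT_oneXWord]; rfl

/-- **THE COMPOUND CHECKER RESTRICTED TO BOX DESIGNS IS THE BOX CHECKER (json side)**: the json-side hypotheses of the compound door
(`hasHyperbolicBFSheafSeedOn_of_nonboxMonadDesign`: Hermitian cells, `CleanX`, `μX ≠ 0`) hold for `toNonbox D` iff the box ones (`Clean`, `μ ≠ 0`)
hold for `D`. -/
theorem toNonbox_jsonSide_iff (D : MonadAlphabet.MonadDesign MonadAlphabet.bAlph) :
    (AllHermMonad (toNonbox D) ∧ (toNonbox D).CleanX ∧ (toNonbox D).muX ≠ 0) ↔ (D.Clean ∧ D.mu ≠ 0) := by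
  rw [cleanX_toNonbox_iff, muX_toNonbox]
  exact ⟨fun h => h.2, fun h => ⟨allHermMonad_toNonbox D, h⟩⟩

end Calibration

/-! ### §26.9 CALIBRATION OF THE FRAMES: `Φ.classOf k (xT T) = Φ.toWordFrame.classOf k T`; the realisation sentences agree; the box door
through the compound door -/

section FrameCalibration

variable {E₀ : AbelianVariety ℂ} {ψ₀ : E₀ ⟶ E₀} {C : ChernCharacterBetti}

/-- **CLASS CALIBRATION**: the degree-`k` class the transported tensor names on a compound frame is the degree-`k` class the tensor names on the
frame's box restriction (the unbalanced words carry `0`; on the balanced ones `xwOf` is a bijection `{wdeg = k} ≃ {balanced, |I| = |J| = k}`). -/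
theorem XWordFrame.classOf_xT (Φ : XWordFrame E₀) (k : ℕ) (T : CWord → GaussianInt) :
    Φ.classOf k (xT T) = Φ.toWordFrame.classOf k T := by
  rw [XWordFrame.classOf, WordFrame.classOf_apply,
    ← Finset.sum_filter_of_ne (p := XBalanced) fun IJ _ hne => by
      by_contra hb
      exact hne (by rw [xT_of_not_xBalanced T hb, map_zero, zero_smul])]
  symm
  -- NB (v25 trap): membership binders are converted with `Finset.mem_coe` explicitly; never let the unifier unfold `wordsOfDeg`.
  refine Finset.sum_nbij xwOf (fun w hw => ?_) (fun w _ w' _ h => xwOf_injective h) (fun IJ hIJ => ?_) (fun w _ => ?_)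
  · rw [Finset.mem_filter, mem_xwordsOfSize, card_xwOf_fst, card_xwOf_snd]
    exact ⟨⟨mem_wordsOfDeg.1 hw, mem_wordsOfDeg.1 hw⟩, xBalanced_xwOf w⟩
  · obtain ⟨hsize, hb⟩ := Finset.mem_filter.1 (Finset.mem_coe.1 hIJ)
    refine ⟨wordOfX IJ, Finset.mem_coe.2 (mem_wordsOfDeg.2 ?_), xwOf_wordOfX hb⟩
    rw [← card_xwOf_fst, xwOf_wordOfX hb]
    exact (mem_xwordsOfSize.1 hsize).1
  · rw [XWordFrame.toWordFrame_cls, xT_xwOf]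

/-- **REALISATION CALIBRATION**: a sheaf realises the transported tensor on the compound frame iff it realises the tensor on the box restriction
(v4 `RealisesTensor`). -/
theorem xRealisesTensor_xT_iff {Φ : XWordFrame E₀} {𝓕 : (pad4Anchor E₀).X.left.Modules} {T : CWord → GaussianInt} :
    XRealisesTensor C Φ 𝓕 (xT T) ↔ RealisesTensor C Φ.toWordFrame 𝓕 T := by
  simp only [XRealisesTensor, RealisesTensor, XWordFrame.classOf_xT]

/-- … at scale `L` (the right-hand side is v24's `RealisesTensorAtScale C Φ.toWordFrame 𝓕 L T`, spelled out — v24 is not imported here). -/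
theorem xRealisesTensorAtScale_xT_iff {Φ : XWordFrame E₀} {𝓕 : (pad4Anchor E₀).X.left.Modules} {L : ℕ} {T : CWord → GaussianInt} :
    XRealisesTensorAtScale C Φ 𝓕 L (xT T) ↔ ∀ p : Fin 9, ((L : ℂ) ^ (p : ℕ)) • C.ch (pad4Anchor E₀).X 𝓕 p = Φ.toWordFrame.classOf p T := by
  simp only [XRealisesTensorAtScale, XWordFrame.classOf_xT]

/-- **THE BOX DOOR THROUGH THE COMPOUND DOOR** (consistency of the two checkers, by name): a box monad design that is (A1)-clean with `μ ≠ 0`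
whose cohomology bundle realises its class tensor at scale `L` on the BOX RESTRICTION of a compound word kit — read on the compound frame via
`toNonbox` — passes `hasHyperbolicBFSheafSeedOn_of_nonboxMonadDesign`. -/
theorem hasHyperbolicBFSheafSeedOn_of_boxMonadDesign_viaCompound (hE : E₀.dim = 1) (hψ : ψ₀ ≫ ψ₀ = -(1 • 𝟙 E₀)) (W : XWordKit E₀ ψ₀)
    (D : MonadAlphabet.MonadDesign MonadAlphabet.bAlph) (hclean : D.Clean) (hμ : D.mu ≠ 0) {L : ℕ} (hL : L ≠ 0)
    {𝓔 : (pad4Anchor E₀).X.left.Modules}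
    (hR : ∀ p : Fin 9, ((L : ℂ) ^ (p : ℕ)) • C.ch (pad4Anchor E₀).X 𝓔 p = W.Φ.toWordFrame.classOf p D.wch) {I : Finset ℕ} (h4 : 4 ∈ I)
    (hI : ∀ p ∈ I, p ≤ 8) (h𝓔 : IsFiniteLocallyFree 𝓔) (hsr : IsISemiregular h𝓔 {q' | q' + 1 ∈ I}) :
    HasHyperbolicBFSheafSeedOn C 4 1 I :=
  hasHyperbolicBFSheafSeedOn_of_nonboxMonadDesign hE hψ W (toNonbox D) (allHermMonad_toNonbox D) ((cleanX_toNonbox_iff D).2 hclean)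
    (by rw [muX_toNonbox]; exact hμ) hL (by rw [wch_toNonbox]; exact xRealisesTensorAtScale_xT_iff.2 hR) h4 hI h𝓔 hsr

end FrameCalibration

/-! ### §26.10 Probes [`decide`-free]: the dictionary on the cells of record -/

section CalibrationProbes

/-- the calibration at the distinguished words, for every box cell: `det M_Z[E] = ch_Z(eeee) = ∏ β_f`, `det M_Z[Ē] = ch_Z(ēēēē)`,
`det M_Z[∅;∅] = 1`-coefficient. -/
theorem compoundCh_boxMatrix_probe (Z : MCell) :
    compoundCh 1 (MonadAlphabet.boxMatrix Z) eXWord = MCell.ch Z eWord ∧ compoundCh 1 (MonadAlphabet.boxMatrix Z) ebarXWord = MCell.ch Z ebarWord ∧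
      compoundCh 1 (MonadAlphabet.boxMatrix Z) oneXWord = MCell.ch Z MonadAlphabet.oneWord := by
  rw [compoundCh_boxMatrix, xT_eXWord, xT_ebarXWord, xT_oneXWord]
  exact ⟨rfl, rfl, rfl⟩

end CalibrationProbes


end Summit.HodgeConjecture.HodgeConjecture.Cruxes.BlochSeedDiscOne.SeedChecker

end
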